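import Literature.MathematicalPhysics.KineticTheory.LangevinChainDynkin
import Literature.MathematicalPhysics.KineticTheory.LangevinChainExpMartingale
import Literature.MathematicalPhysics.KineticTheory.LangevinChainDissipation
import Literature.Probability.Process.BrownianSupTail
import Mathlib.MeasureTheory.Integral.MeanInequalities
import HarnessLib

/-!
# CEHR Theorem 5.1 / Remark 5.2 (the Lyapunov condition H2) for the pinned anharmonic chain, proved

Trunk T-KINETIC (Literature/MathematicalPhysics/KineticTheory). Cuneo–Eckmann–Hairer–Rey-Bellet,
EJP 23 (2018) no. 55, Theorem 5.1 with Remark 5.2 (arXiv:1712.09413 pp. 17–23): for `t* > 0` and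
`θ < 1/T_max`, `E_z e^{θH(z_{t*})} ≤ κ e^{θH(z)} + c 1_K(z)` with `κ < 1`. This file PROVES it for
the transition semigroup of the pinned chain constructed in the tree (`LangevinChainKernel.lean`,
`LangevinChainDynkin.lean`), for `lam > 0` (degrees `ℓ_i = ℓ_p = 4`) and `N ≥ 2`, following the
printed proof of §5 but on a DETERMINISTIC time grid `t_j = jτ` (`τ ≍ H(z)^{-1/4}`, the time scale
(5.5)) instead of the stopping times `τ_j` of (5.8) — the simple Markov property at the grid times
and the law of the shifted Brownian pair replace the strong Markov property:

* partition of the path space by the grid energies and the noise increments: `A₂' = {∃ j, H(z_{t_j})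
  < E/2}`, `A₃' = {∃ j, H(z_{t_j}) > 3E/2}`, `N = {∃ j, sup_{[t_j,t_{j+1}]} |ΔB| large}`; off these,
  every cell starts in `[E/2, 3E/2]` with a small noise increment, so by the energy-jump bound the
  energy stays `≤ 2E` on the cell (the event `Ã`) and by the deterministic core of Prop. 5.3
  (`LangevinChainDissipation.lean`) each cell dissipates `Γ ≥ γε₁Eτ`, whence `Γ(t*) ≥ γε₁E t*`
  (Corollary 5.4, here sure); then `E[e^{θH(z_{t*})}; Γ(t*) ≥ g] ≤ e^{-κg} e^{C t*} e^{θE}` by the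
  exponential-supermartingale bound (Lemma 5.5, `LangevinChainExpMartingale.lean`);
* `A₂'` (the event `A₂` of the printed proof): restart at `t_j` (Markov property) and (3.4),
  `≤ (J+1) e^{C t*} e^{θE/2}` ((5.15));
* `A₃' ∪ N` (the event `A₃` and the large-noise cells): Hölder with (3.4) at an exponent `pθ < 1/T_max`
  and `P(A₃') ≤ (J+1)e^{Ct*}e^{-θE/2}` (Chebyshev, cf. Lemma 5.6), `P(N) ≤ J · O(τ²/a⁴)`
  (`BrownianSupTail.lean`) ((5.16)).
(The sibling file `LangevinChainH2.lean` of the provefact unit of `CuneoEckmannHairerReyBellet2018_H2`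
develops a related window-based shell; this file is self-contained given its imports.)
Summing, `E_z e^{θH(z_{t*}) - θH(z)} → 0` as `H(z) → ∞` (`pinnedChain_lintegral_exp_hamiltonian_small`),
which gives Remark 5.2's form `pinnedChain_H2_of_pos` (the statement of the named fact
`CuneoEckmannHairerReyBellet2018_H2` for `lam > 0`, `N ≥ 2`), hence — with the Gibbs steady state
for `N = 1` (`LangevinChainGibbs.lean`) — the weak-stationarity fact
`CuneoEckmannHairerReyBellet2018_pinnedChain` from Hörmander's theorem alone
(`CuneoEckmannHairerReyBellet2018_pinnedChain_of_hormander`).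

## References

* N. Cuneo, J.-P. Eckmann, M. Hairer, L. Rey-Bellet, *Non-equilibrium steady states for networks of
  oscillators*, EJP 23 (2018) no. 55 (arXiv:1712.09413), Thm 5.1, Rem 5.2, Prop. 5.3, Cor. 5.4,
  Lemmas 5.5–5.6, eqs. (5.14)–(5.16).
* L. Rey-Bellet, L. E. Thomas, CMP 225 (2002) 305–329, Thm 3.1 (the same Lyapunov estimate).
-/

noncomputable section

open MeasureTheory ProbabilityTheory Filter Topology Set Metric Finset
open scoped NNReal ENNReal Topology BoundedContinuousFunction

namespace Literature.MathematicalPhysics.KineticTheory.HeatConduction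

open Literature.Probability.Process OscillatorChain

variable {N : ℕ}

/-! ### Good noise paths: small increments on a cell -/

/-- The set of pairs of paths whose values at the dyadic times `m/2ⁿ ≤ h` are bounded by `a` in
absolute value (on continuous paths: `sup_{s ≤ h} |w_i(s)| ≤ a`, `abs_le_of_mem_goodPaths`); the
good event of `BrownianSupTail.lean` is its preimage under `pairPath` (`goodEvent_eq_preimage`).
[folklore] -/
def goodPaths (a : ℝ) (h : ℝ≥0) : Set WienerPair :=
  {w | ∀ n m : ℕ, ((m : ℝ≥0) / 2 ^ n ≤ h) → |w.1 ((m : ℝ≥0) / 2 ^ n)| ≤ a ∧ |w.2 ((m : ℝ≥0) / 2 ^ n)| ≤ a}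

/-- `goodPaths` is measurable (countably many coordinate conditions). [folklore] -/
theorem measurableSet_goodPaths (a : ℝ) (h : ℝ≥0) : MeasurableSet (goodPaths a h) := by
  have : goodPaths a h = ⋂ n : ℕ, ⋂ m : ℕ, {w : WienerPair | ((m : ℝ≥0) / 2 ^ n ≤ h) →
      |w.1 ((m : ℝ≥0) / 2 ^ n)| ≤ a ∧ |w.2 ((m : ℝ≥0) / 2 ^ n)| ≤ a} := by
    ext w; simp [goodPaths]
  rw [this]
  refine MeasurableSet.iInter fun n => MeasurableSet.iInter fun m => ?_
  by_cases hmn : (m : ℝ≥0) / 2 ^ n ≤ h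
  · simp only [hmn, true_implies]
    exact (measurableSet_le ((measurable_pi_apply _).comp measurable_fst).abs measurable_const).inter
      (measurableSet_le ((measurable_pi_apply _).comp measurable_snd).abs measurable_const)
  · simp [hmn]

/-- The good event of the Brownian pair is the preimage of `goodPaths` under `pairPath`. [folklore] -/
theorem goodEvent_eq_preimage (a : ℝ) (h : ℝ≥0) : goodEvent a h = pairPath ⁻¹' goodPaths a h := rfl

/-- **On good continuous paths the bound holds at all times `s ≤ h`** (dyadic approximation from
below and continuity). [folklore] -/
theorem abs_le_of_mem_goodPaths {a : ℝ} {h : ℝ≥0} {w : WienerPair} (hw : w ∈ goodPaths a h)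
    (h1 : Continuous w.1) (h2 : Continuous w.2) {s : ℝ≥0} (hs : s ≤ h) :
    |w.1 s| ≤ a ∧ |w.2 s| ≤ a := by
  set r : ℕ → ℝ≥0 := fun n => ((⌊(s : ℝ) * 2 ^ n⌋₊ : ℕ) : ℝ≥0) / 2 ^ n with hr
  have hrs : ∀ n, r n ≤ s := fun n => by
    rw [hr]
    show ((⌊(s : ℝ) * 2 ^ n⌋₊ : ℕ) : ℝ≥0) / 2 ^ n ≤ s
    rw [div_le_iff₀ (pow_pos two_pos n), ← NNReal.coe_le_coe]
    push_cast
    exact Nat.floor_le (by positivity)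
  have hten : Tendsto r atTop (𝓝 s) := tendsto_nat_floor_div_two_pow s
  have hgood : ∀ n, |w.1 (r n)| ≤ a ∧ |w.2 (r n)| ≤ a := fun n => hw n (⌊(s : ℝ) * 2 ^ n⌋₊) ((hrs n).trans hs)
  constructor
  · exact le_of_tendsto' (((continuous_abs.comp h1).tendsto s).comp hten) fun n => (hgood n).1
  · exact le_of_tendsto' (((continuous_abs.comp h2).tendsto s).comp hten) fun n => (hgood n).2

/-- **The law of the shifted bad event is the law of the bad event**: `P(θ_s ω ∉ goodPaths) =
P((goodEvent)ᶜ)` (the shifted pair has the law of the pair, `map_pairShift_eq_map_pairPath`).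
[folklore] -/
theorem measure_pairShift_not_mem_goodPaths (s : ℝ≥0) (a : ℝ) (h : ℝ≥0) :
    wienerPair {ω | pairShift s ω ∉ goodPaths a h} = wienerPair (goodEvent a h)ᶜ := by
  have h1 : {ω | pairShift s ω ∉ goodPaths a h} = pairShift s ⁻¹' (goodPaths a h)ᶜ := rfl
  have h2 : (goodEvent a h)ᶜ = pairPath ⁻¹' (goodPaths a h)ᶜ := by rw [goodEvent_eq_preimage]; rfl
  rw [h1, h2, ← Measure.map_apply (measurable_pairShift (s := s)) (measurableSet_goodPaths a h).compl,
    ← Measure.map_apply measurable_pairPath (measurableSet_goodPaths a h).compl, map_pairShift_eq_map_pairPath]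

/-- **On a good shifted pair the shifted noise is small**: for `N ≥ 2`, if
`θ_s ω ∈ goodPaths a h` then `‖η(θ_s ω)(u)‖ ≤ max(c_L, c_R) a` for `u ∈ [0, h]`
(`c_b = √(2γT_b)`; each momentum carries at most one bath). [folklore] -/
theorem norm_pairNoise_pairShift_le (P : OscillatorChain) (hN : 1 < N) (T_L T_R : ℝ) {s : ℝ≥0} {a : ℝ}
    (ha : 0 ≤ a) {h : ℝ≥0} {ω : WienerPair} (hω : pairShift s ω ∈ goodPaths a h) {u : ℝ} (hu0 : 0 ≤ u)
    (hu : u ≤ h) :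
    ‖P.pairNoise N T_L T_R (pairShift s ω) u‖ ≤ max (Real.sqrt (2 * P.γ * T_L)) (Real.sqrt (2 * P.γ * T_R)) * a := by
  have hgood := abs_le_of_mem_goodPaths hω (continuous_pairShift_fst (s := s) ω) (continuous_pairShift_snd (s := s) ω)
    (s := u.toNNReal) (by rw [← NNReal.coe_le_coe, Real.coe_toNNReal u hu0]; exact hu)
  refine (pi_norm_le_iff_of_nonneg (by positivity)).2 fun i => ?_
  unfold OscillatorChain.pairNoise
  rw [chainNoise_of_continuous _ _ (continuous_pairShift_fst (s := s) ω) (continuous_pairShift_snd (s := s) ω),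
    pairShift_fst_zero, pairShift_snd_zero, sub_zero, sub_zero, Real.norm_eq_abs]
  have hcL : 0 ≤ Real.sqrt (2 * P.γ * T_L) := Real.sqrt_nonneg _
  have hcR : 0 ≤ Real.sqrt (2 * P.γ * T_R) := Real.sqrt_nonneg _
  by_cases h0 : i.val = 0
  · have h1 : ¬ i.val = N - 1 := by omega
    rw [if_pos h0, if_neg h1, zero_mul, add_zero, abs_mul, abs_of_nonneg hcL]
    exact mul_le_mul (le_max_left _ _) hgood.1 (abs_nonneg _) (by positivity)
  · rw [if_neg h0, zero_mul, zero_add]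
    by_cases h1 : i.val = N - 1
    · rw [if_pos h1, abs_mul, abs_of_nonneg hcR]
      exact mul_le_mul (le_max_right _ _) hgood.2 (abs_nonneg _) (by positivity)
    · rw [if_neg h1, zero_mul, abs_zero]
      positivity

/-! ### The dissipation along the grid -/

section Grid

variable {ω₂ lam β γ : ℝ} (hω : 0 < ω₂) (hl : 0 ≤ lam) (hβ : 0 ≤ β) (hγ : 0 ≤ γ) (N : ℕ)
  (T_L T_R : ℝ)
include hω hl hβ hγ

/-- The dissipation on `[0, t]` only depends on the noise on `[0, t]`. [folklore] -/
theorem pinnedChain_dissipation_congr (x : PhaseSpace N) {η₁ η₂ : ℝ → Fin N → ℝ} (h₁ : Continuous η₁)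
    (h₂ : Continuous η₂) {t : ℝ} (ht : 0 ≤ t) (h : EqOn η₁ η₂ (Icc 0 t)) :
    (pinnedChain ω₂ lam β γ).dissipation N x η₁ t = (pinnedChain ω₂ lam β γ).dissipation N x η₂ t := by
  unfold OscillatorChain.dissipation
  congr 1
  refine intervalIntegral.integral_congr fun s hs => ?_
  rw [uIcc_of_le ht] at hs
  rw [pinnedChain_chainFlow_congr hω hl hβ hγ N x h₁ h₂ (T := t) h hs]

/-- **One step of the grid for the dissipation**: `Γ_{s+u}(x, B(ω)) = Γ_s(x, B(ω)) +
Γ_u(Φ_s(x, B(ω)), θ_s ω)` (additivity along the cocycle and `η(θ_s ω) = η(ω)(s+·) - η(ω)(s)` on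
`u ≥ 0`). [folklore] -/
theorem pinnedChain_dissipation_pairShift (x : PhaseSpace N) (s : ℝ≥0) {u : ℝ} (hu : 0 ≤ u) (ω : WienerPair) :
    (pinnedChain ω₂ lam β γ).dissipation N x ((pinnedChain ω₂ lam β γ).pairNoise N T_L T_R (pairPath ω)) (s + u) =
      (pinnedChain ω₂ lam β γ).dissipation N x ((pinnedChain ω₂ lam β γ).pairNoise N T_L T_R (pairPath ω)) s +
        (pinnedChain ω₂ lam β γ).dissipation N ((pinnedChain ω₂ lam β γ).solMap N T_L T_R s x (pairPath ω))
          ((pinnedChain ω₂ lam β γ).pairNoise N T_L T_R (pairShift s ω)) u := by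
  set P := pinnedChain ω₂ lam β γ with hP
  have hηc : Continuous (P.pairNoise N T_L T_R (pairPath ω)) := P.continuous_pairNoise N T_L T_R _
  rw [pinnedChain_dissipation_add hω hl hβ hγ N x hηc s.coe_nonneg hu, P.solMap_eq_chainFlow]
  congr 1
  refine pinnedChain_dissipation_congr hω hl hβ hγ N _ ?_ (P.continuous_pairNoise N T_L T_R _) hu fun r hr => ?_
  · exact (hηc.comp (continuous_const_add _)).sub continuous_const
  · exact (P.pairNoise_pairShift N T_L T_R s ω hr.1).symm

/-- **The dissipation over `J` cells is the sum of the cell dissipations of the restarted flows**: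
`Γ_{Jτ}(x, B(ω)) = ∑_{j<J} Γ_τ(Φ_{jτ}(x, B(ω)), θ_{jτ} ω)`. [folklore] -/
theorem pinnedChain_dissipation_grid (x : PhaseSpace N) {τ : ℝ} (hτ : 0 ≤ τ) (ω : WienerPair) :
    ∀ J : ℕ, (pinnedChain ω₂ lam β γ).dissipation N x ((pinnedChain ω₂ lam β γ).pairNoise N T_L T_R (pairPath ω)) (J * τ) =
      ∑ j ∈ range J, (pinnedChain ω₂ lam β γ).dissipation N
        ((pinnedChain ω₂ lam β γ).solMap N T_L T_R (j * τ) x (pairPath ω))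
        ((pinnedChain ω₂ lam β γ).pairNoise N T_L T_R (pairShift ((j : ℝ) * τ).toNNReal ω)) τ
  | 0 => by simp
  | J + 1 => by
    have ih := pinnedChain_dissipation_grid x hτ ω J
    have hJτ : (0 : ℝ) ≤ J * τ := by positivity
    rw [sum_range_succ, ← ih, Nat.cast_succ, add_mul, one_mul]
    have h := pinnedChain_dissipation_pairShift hω hl hβ hγ N T_L T_R x ((J : ℝ) * τ).toNNReal hτ ω
    rwa [Real.coe_toNNReal _ hJτ] at h

end Grid

/-! ### The energy stays below `2a⁴` on a cell with small noise (the event `Ã`) -/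

section Cell

variable {ω₂ lam β γ : ℝ} (hω : 0 < ω₂) (hl : 0 ≤ lam) (hβ : 0 ≤ β) (hγ : 0 ≤ γ) (N : ℕ)
include hω hl hβ hγ

/-- **The cell lemma**: there are `m₀ > 0` and `a₁ ≥ 1` (depending on the chain and on `Λ`) such
that for `a ≥ a₁`, a start with `H(x) ≤ 3a⁴/2`, a cell length `τ ≤ 2Λ/a` and a continuous noise path
with `‖η‖ ≤ m₀ a` on `[0, τ]`, the energy stays `≤ 2a⁴` on `[0, τ]` (energy-jump bound of
`LangevinChainEnergyIdentity.lean`: `H ≤ A + M√(2NA) + NM²/2`, `A = (1+H(x))e^{CMτ} - 1`).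
[cite: CuneoEckmannHairerReyBellet2018, Prop 5.3 (the event `Ã`)] -/
theorem pinnedChain_cell_energy_le {Λ : ℝ} (hΛ : 0 < Λ) :
    ∃ m₀ a₁ : ℝ, 0 < m₀ ∧ 1 ≤ a₁ ∧ ∀ ⦃a : ℝ⦄, a₁ ≤ a → ∀ ⦃τ : ℝ⦄, 0 ≤ τ → τ ≤ 2 * Λ / a →
      ∀ x : PhaseSpace N, (pinnedChain ω₂ lam β γ).hamiltonian N x ≤ 3 * a ^ 4 / 2 →
        ∀ ⦃η : ℝ → Fin N → ℝ⦄, Continuous η → (∀ s ∈ Icc 0 τ, ‖η s‖ ≤ m₀ * a) →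
          ∀ s ∈ Icc 0 τ, (pinnedChain ω₂ lam β γ).hamiltonian N ((pinnedChain ω₂ lam β γ).chainFlow N x η s) ≤ 2 * a ^ 4 := by
  set C := pinnedChainEnergyConst ω₂ lam β γ N with hC
  have hC0 : 0 ≤ C := pinnedChainEnergyConst_nonneg hω hl hβ γ N
  -- `m₀`: `e^{2CΛm₀} ≤ 6/5`, i.e. `2CΛm₀ ≤ log(6/5)`; we use `e^y ≤ 1 + 2y` for `y ≤ 1/2`... simpler: `y ≤ 1/12`
  set m₀ : ℝ := 1 / (24 * (C + 1) * Λ) with hm₀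
  have hm₀0 : 0 < m₀ := by positivity
  set c₁ : ℝ := 2 * N * m₀ + N * m₀ ^ 2 / 2 with hc₁
  have hc₁0 : 0 ≤ c₁ := by positivity
  set a₁ : ℝ := max 2 (10 * c₁ + 1) with ha₁
  refine ⟨m₀, a₁, hm₀0, (by norm_num : (1 : ℝ) ≤ 2).trans (le_max_left _ _), ?_⟩
  intro a ha τ hτ0 hτ x hx η hηc hηb s hs
  have ha2 : 2 ≤ a := (le_max_left _ _).trans ha
  have ha1 : 1 ≤ a := by linarith only [ha2]
  have ha0 : 0 < a := by linarith only [ha2]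
  have hac : 10 * c₁ + 1 ≤ a := (le_max_right _ _).trans ha
  set M := m₀ * a with hM
  have hM0 : 0 ≤ M := by positivity
  have hjump := pinnedChain_hamiltonian_chainFlow_le_of_noise hω hl hβ hγ N x hηc hηb hs
  -- the exponent `C M s ≤ 2CΛm₀ ≤ 1/12`
  have hexp_arg : C * M * s ≤ 1 / 12 := by
    have hs' : s ≤ 2 * Λ / a := hs.2.trans hτ
    calc C * M * s ≤ C * M * (2 * Λ / a) := mul_le_mul_of_nonneg_left hs' (by positivity)
      _ = 2 * C * Λ * m₀ := by rw [hM]; field_simp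
      _ ≤ 2 * (C + 1) * Λ * m₀ := by gcongr; linarith only
      _ = 1 / 12 := by rw [hm₀]; field_simp; ring
  have hexp : Real.exp (C * M * s) ≤ 6 / 5 := by
    have h1 : Real.exp (C * M * s) ≤ Real.exp (1 / 12) := Real.exp_le_exp.2 hexp_arg
    have h2 : Real.exp (1 / 12) ≤ 6 / 5 := by
      have := Real.exp_bound_div_one_sub_of_interval' (x := 1 / 12) (by norm_num) (by norm_num)
      -- `exp x < 1/(1 - x)` for `0 < x < 1`
      linarith only [this, show (1 : ℝ) / (1 - 1 / 12) = 12 / 11 by norm_num]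
    exact h1.trans h2
  set A := (1 + (pinnedChain ω₂ lam β γ).hamiltonian N x) * Real.exp (C * M * s) - 1 with hA
  have hHx0 := pinnedChain_hamiltonian_nonneg hω.le hl hβ γ N x
  have hA_le : A ≤ 1 / 5 + 9 * a ^ 4 / 5 := by
    rw [hA]
    have : (1 + (pinnedChain ω₂ lam β γ).hamiltonian N x) * Real.exp (C * M * s) ≤ (1 + 3 * a ^ 4 / 2) * (6 / 5) :=
      mul_le_mul (by linarith only [hx]) hexp (Real.exp_pos _).le (by positivity)
    linarith only [this]
  have hA0 : 0 ≤ A := by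
    rw [hA]
    have h1 : (1 : ℝ) ≤ Real.exp (C * M * s) := Real.one_le_exp (mul_nonneg (mul_nonneg hC0 hM0) hs.1)
    have : 1 ≤ (1 + (pinnedChain ω₂ lam β γ).hamiltonian N x) * Real.exp (C * M * s) :=
      one_le_mul_of_one_le_of_one_le (by linarith only [hHx0]) h1
    linarith only [this]
  have ha4 : 1 ≤ a ^ 4 := one_le_pow₀ ha1
  have hA2 : A ≤ 2 * a ^ 4 := by linarith only [hA_le, ha4]
  -- `√(2 N A) ≤ 2 N a²`
  have hsqrt : Real.sqrt (2 * N * A) ≤ 2 * N * a ^ 2 := by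
    rw [Real.sqrt_le_iff]
    constructor
    · positivity
    · have hN1 : (N : ℝ) ≤ (N : ℝ) ^ 2 := by
        rcases Nat.eq_zero_or_pos N with h | h
        · simp [h]
        · exact le_self_pow₀ (by exact_mod_cast h) two_ne_zero
      have h3 := mul_le_mul_of_nonneg_right hN1 (by positivity : (0 : ℝ) ≤ 4 * a ^ 4)
      calc 2 * (N : ℝ) * A ≤ 2 * N * (2 * a ^ 4) := mul_le_mul_of_nonneg_left hA2 (by positivity)
        _ = N * (4 * a ^ 4) := by ring
        _ ≤ (N : ℝ) ^ 2 * (4 * a ^ 4) := h3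
        _ = (2 * N * a ^ 2) ^ 2 := by ring
  have ha23 : a ^ 2 ≤ a ^ 3 := pow_le_pow_right₀ ha1 (by norm_num)
  calc (pinnedChain ω₂ lam β γ).hamiltonian N ((pinnedChain ω₂ lam β γ).chainFlow N x η s)
      ≤ A + M * Real.sqrt (2 * N * A) + N * M ^ 2 / 2 := hjump
    _ ≤ (1 / 5 + 9 * a ^ 4 / 5) + m₀ * a * (2 * N * a ^ 2) + N * (m₀ * a) ^ 2 / 2 := by
        rw [hM]; gcongr
    _ = 1 / 5 + 9 * a ^ 4 / 5 + (2 * N * m₀) * a ^ 3 + (N * m₀ ^ 2 / 2) * a ^ 2 := by ring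
    _ ≤ 1 / 5 + 9 * a ^ 4 / 5 + c₁ * a ^ 3 := by
        have h4 : (N * m₀ ^ 2 / 2) * a ^ 2 ≤ (N * m₀ ^ 2 / 2) * a ^ 3 :=
          mul_le_mul_of_nonneg_left ha23 (by positivity)
        have h5 : c₁ * a ^ 3 = (2 * N * m₀) * a ^ 3 + (N * m₀ ^ 2 / 2) * a ^ 3 := by rw [hc₁]; ring
        linarith only [h4, h5]
    _ ≤ 2 * a ^ 4 := by
        -- `1/5 ≤ a⁴/10` (as `a ≥ 2`) and `c₁ a³ ≤ a⁴/10` (as `a ≥ 10 c₁`)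
        have h16 : (2 : ℝ) ^ 4 ≤ a ^ 4 := pow_le_pow_left₀ (by norm_num) ha2 4
        have h1 : (1 : ℝ) / 5 ≤ a ^ 4 / 10 := by norm_num at h16 ⊢; linarith only [h16]
        have h6 := mul_le_mul_of_nonneg_right (by linarith only [hac] : 10 * c₁ ≤ a) (pow_nonneg ha0.le 3)
        have h2 : c₁ * a ^ 3 ≤ a ^ 4 / 10 := by
          have h7 : a * a ^ 3 = a ^ 4 := by ring
          linarith only [h6, h7]
        linarith only [h1, h2]

end Cell

/-! ### Markov restart, Chebyshev and Hölder for the constructed semigroup -/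

section Estimates

variable {ω₂ lam β γ : ℝ} (hω : 0 < ω₂) (hl : 0 ≤ lam) (hβ : 0 ≤ β) (hγ : 0 ≤ γ) {N : ℕ} (hN : 0 < N)
  {T_L T_R : ℝ} (hTL : 0 < T_L) (hTR : 0 < T_R) {θ : ℝ} (hθ : 0 < θ) (hθ' : θ < 1 / max T_L T_R)
include hω hl hβ hγ hN hTL hTR hθ hθ'

/-- **(3.4) along the flow**: `E exp(θ H(Φ_t(z, B))) ≤ e^{θγ(T_L+T_R)t} e^{θH(z)}`.
[cite: CuneoEckmannHairerReyBellet2018, §3 eq. (3.4)] -/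
theorem pinnedChain_lintegral_exp_hamiltonian_solMap_le (t : ℝ≥0) (z : PhaseSpace N) :
    ∫⁻ ω, ENNReal.ofReal (Real.exp (θ * (pinnedChain ω₂ lam β γ).hamiltonian N
        ((pinnedChain ω₂ lam β γ).solMap N T_L T_R t z (pairPath ω)))) ∂wienerPair ≤
      ENNReal.ofReal (Real.exp (θ * γ * (T_L + T_R) * t) *
        Real.exp (θ * (pinnedChain ω₂ lam β γ).hamiltonian N z)) := by
  have hmeas : Measurable fun y : PhaseSpace N => ENNReal.ofReal (Real.exp (θ * (pinnedChain ω₂ lam β γ).hamiltonian N y)) :=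
    ENNReal.measurable_ofReal.comp (Real.measurable_exp.comp
      ((pinnedChain_continuous_hamiltonian ω₂ lam β γ N).measurable.const_mul _))
  rw [← pinnedChain_lintegral_transitionKernel hω hl hβ hγ N T_L T_R t z hmeas]
  exact lintegral_exp_mul_hamiltonian_pinnedChainSemigroup_le hω hl hβ hγ hN hTL.le hTR.le hTL hTR hθ hθ' t z

/-- **Restart at a grid time** (the simple Markov property replaces the strong one of the printed
proof): for a measurable set `B` of states, `s, u ≥ 0`,
`E[1_B(z_s) e^{θH(z_{s+u})}] ≤ e^{θγ(T_L+T_R)u} E[1_B(z_s) e^{θH(z_s)}]` — factorise at time `s`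
(`lintegral_comp_pairShift_eq`, the cocycle property) and apply (3.4) from the restarted state.
[cite: CuneoEckmannHairerReyBellet2018, Thm 5.1 (proof, eq. (5.15))] -/
theorem pinnedChain_lintegral_indicator_exp_hamiltonian_restart_le (s : ℝ≥0) {u : ℝ} (hu : 0 ≤ u) (x : PhaseSpace N)
    {B : Set (PhaseSpace N)} (hB : MeasurableSet B) :
    ∫⁻ ω, B.indicator 1 ((pinnedChain ω₂ lam β γ).solMap N T_L T_R s x (pairPath ω)) *
        ENNReal.ofReal (Real.exp (θ * (pinnedChain ω₂ lam β γ).hamiltonian N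
          ((pinnedChain ω₂ lam β γ).solMap N T_L T_R (s + u) x (pairPath ω)))) ∂wienerPair ≤
      ENNReal.ofReal (Real.exp (θ * γ * (T_L + T_R) * u)) *
        ∫⁻ ω, B.indicator 1 ((pinnedChain ω₂ lam β γ).solMap N T_L T_R s x (pairPath ω)) *
          ENNReal.ofReal (Real.exp (θ * (pinnedChain ω₂ lam β γ).hamiltonian N
            ((pinnedChain ω₂ lam β γ).solMap N T_L T_R s x (pairPath ω)))) ∂wienerPair := by
  set P := pinnedChain ω₂ lam β γ with hP
  have hVm : Measurable fun y : PhaseSpace N => ENNReal.ofReal (Real.exp (θ * P.hamiltonian N y)) :=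
    ENNReal.measurable_ofReal.comp (Real.measurable_exp.comp
      ((pinnedChain_continuous_hamiltonian ω₂ lam β γ N).measurable.const_mul _))
  set G : PhaseSpace N × WienerPair → ℝ≥0∞ := fun p => B.indicator 1 p.1 *
    ENNReal.ofReal (Real.exp (θ * P.hamiltonian N (P.solMap N T_L T_R u p.1 p.2))) with hG
  have hGm : Measurable G := ((measurable_one.indicator hB).comp measurable_fst).mul
    (hVm.comp (pinnedChain_measurable_solMap hω hl hβ hγ N T_L T_R u))
  have hξ := pinnedChain_measurable_comap_pairPast_solMap hω hl hβ hγ N T_L T_R s x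
  -- cocycle: the integrand is `G(z_s, θ_s ω)`
  have hL : ∀ ω, B.indicator 1 (P.solMap N T_L T_R s x (pairPath ω)) *
      ENNReal.ofReal (Real.exp (θ * P.hamiltonian N (P.solMap N T_L T_R (s + u) x (pairPath ω)))) =
      G (P.solMap N T_L T_R s x (pairPath ω), pairShift s ω) := fun ω => by
    rw [pinnedChain_solMap_add_pairPath hω hl hβ hγ N T_L T_R s hu x ω]
  simp_rw [hL]
  rw [lintegral_comp_pairShift_eq s hξ hGm]
  -- the inner integral is `1_B(z_s) P_u V(z_s) ≤ 1_B(z_s) e^{Cu} V(z_s)`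
  have hinner : ∀ ω, ∫⁻ ω', G (P.solMap N T_L T_R s x (pairPath ω), pairPath ω') ∂wienerPair ≤
      ENNReal.ofReal (Real.exp (θ * γ * (T_L + T_R) * u)) *
        (B.indicator 1 (P.solMap N T_L T_R s x (pairPath ω)) *
          ENNReal.ofReal (Real.exp (θ * P.hamiltonian N (P.solMap N T_L T_R s x (pairPath ω))))) := by
    intro ω
    simp only [hG]
    have hm2 : Measurable fun ω' => ENNReal.ofReal (Real.exp (θ * P.hamiltonian N
        (P.solMap N T_L T_R u (P.solMap N T_L T_R s x (pairPath ω)) (pairPath ω')))) :=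
      hVm.comp (pinnedChain_measurable_solMap_pairPath_right hω hl hβ hγ N T_L T_R u _)
    rw [lintegral_const_mul _ hm2]
    have h34 := pinnedChain_lintegral_exp_hamiltonian_solMap_le hω hl hβ hγ hN hTL hTR hθ hθ' u.toNNReal
      (P.solMap N T_L T_R s x (pairPath ω))
    rw [Real.coe_toNNReal u hu] at h34
    calc B.indicator 1 (P.solMap N T_L T_R s x (pairPath ω)) *
          ∫⁻ ω', ENNReal.ofReal (Real.exp (θ * P.hamiltonian N
            (P.solMap N T_L T_R u (P.solMap N T_L T_R s x (pairPath ω)) (pairPath ω')))) ∂wienerPair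
        ≤ B.indicator 1 (P.solMap N T_L T_R s x (pairPath ω)) *
          ENNReal.ofReal (Real.exp (θ * γ * (T_L + T_R) * u) * Real.exp (θ * P.hamiltonian N (P.solMap N T_L T_R s x (pairPath ω)))) := by
          gcongr
      _ = _ := by
          rw [ENNReal.ofReal_mul (Real.exp_pos _).le]
          ring
  have hmeas : Measurable fun ω => B.indicator 1 (P.solMap N T_L T_R s x (pairPath ω)) *
      ENNReal.ofReal (Real.exp (θ * P.hamiltonian N (P.solMap N T_L T_R s x (pairPath ω)))) :=
    ((measurable_one.indicator hB).comp (pinnedChain_measurable_solMap_pairPath_right hω hl hβ hγ N T_L T_R s x)).mul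
      (hVm.comp (pinnedChain_measurable_solMap_pairPath_right hω hl hβ hγ N T_L T_R s x))
  calc ∫⁻ ω, ∫⁻ ω', G (P.solMap N T_L T_R s x (pairPath ω), pairPath ω') ∂wienerPair ∂wienerPair
      ≤ ∫⁻ ω, ENNReal.ofReal (Real.exp (θ * γ * (T_L + T_R) * u)) *
          (B.indicator 1 (P.solMap N T_L T_R s x (pairPath ω)) *
            ENNReal.ofReal (Real.exp (θ * P.hamiltonian N (P.solMap N T_L T_R s x (pairPath ω))))) ∂wienerPair :=
        lintegral_mono hinner
    _ = _ := lintegral_const_mul _ hmeas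

/-- **Chebyshev for a grid energy** (cf. CEHR Lemma 5.6): `P(c < H(z_t)) ≤ e^{-θc} e^{θγ(T_L+T_R)t} e^{θH(x)}`.
[cite: CuneoEckmannHairerReyBellet2018, Lemma 5.6] -/
theorem pinnedChain_measure_lt_hamiltonian_solMap_le (t : ℝ≥0) (x : PhaseSpace N) (c : ℝ) :
    wienerPair {ω | c < (pinnedChain ω₂ lam β γ).hamiltonian N ((pinnedChain ω₂ lam β γ).solMap N T_L T_R t x (pairPath ω))} ≤
      ENNReal.ofReal (Real.exp (-(θ * c)) * (Real.exp (θ * γ * (T_L + T_R) * t) *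
        Real.exp (θ * (pinnedChain ω₂ lam β γ).hamiltonian N x))) := by
  set P := pinnedChain ω₂ lam β γ with hP
  set f : WienerPair → ℝ≥0∞ := fun ω => ENNReal.ofReal (Real.exp (θ * P.hamiltonian N (P.solMap N T_L T_R t x (pairPath ω)))) with hf
  have hfm : Measurable f := ENNReal.measurable_ofReal.comp (Real.measurable_exp.comp
    (((pinnedChain_continuous_hamiltonian ω₂ lam β γ N).measurable.comp
      (pinnedChain_measurable_solMap_pairPath_right hω hl hβ hγ N T_L T_R t x)).const_mul _))
  have hsub : {ω | c < P.hamiltonian N (P.solMap N T_L T_R t x (pairPath ω))} ⊆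
      {ω | ENNReal.ofReal (Real.exp (θ * c)) ≤ f ω} := by
    intro ω hω
    simp only [Set.mem_setOf_eq] at hω ⊢
    exact ENNReal.ofReal_le_ofReal (Real.exp_le_exp.2 (by nlinarith))
  refine (measure_mono hsub).trans ?_
  have h1 := meas_ge_le_lintegral_div (μ := wienerPair) hfm.aemeasurable (ε := ENNReal.ofReal (Real.exp (θ * c)))
    (by simp [Real.exp_pos]) ENNReal.ofReal_ne_top
  refine h1.trans ?_
  rw [ENNReal.div_le_iff (by simp [Real.exp_pos]) ENNReal.ofReal_ne_top, ← ENNReal.ofReal_mul (by positivity)]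
  refine (pinnedChain_lintegral_exp_hamiltonian_solMap_le hω hl hβ hγ hN hTL hTR hθ hθ' t x).trans (le_of_eq ?_)
  congr 1
  rw [Real.exp_neg]
  field_simp
  rfl

omit hθ' in
/-- **Hölder with (3.4)** (the step "by Lemma 5.5 …, `≤ e^{C_*t*}(P_{z₀}(A))^{1/q}`" of (5.14)/(5.16),
here with the moment bound (3.4) at the exponent `pθ < 1/T_max`): for `p > 1` with
`pθ < 1/T_max`, `q` the conjugate exponent, and a measurable set `S` of paths,
`E[e^{θH(z_t)}; S] ≤ e^{θγ(T_L+T_R)t} e^{θH(x)} P(S)^{1/q}`.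
[cite: CuneoEckmannHairerReyBellet2018, Thm 5.1 (proof, eqs. (5.14), (5.16))] -/
theorem pinnedChain_lintegral_indicator_exp_hamiltonian_le_rpow {p : ℝ} (hp : 1 < p) (hpθ : p * θ < 1 / max T_L T_R)
    (t : ℝ≥0) (x : PhaseSpace N) {S : Set WienerPair} (hS : MeasurableSet S) :
    ∫⁻ ω, S.indicator 1 ω * ENNReal.ofReal (Real.exp (θ * (pinnedChain ω₂ lam β γ).hamiltonian N
        ((pinnedChain ω₂ lam β γ).solMap N T_L T_R t x (pairPath ω)))) ∂wienerPair ≤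
      ENNReal.ofReal (Real.exp (θ * γ * (T_L + T_R) * t) * Real.exp (θ * (pinnedChain ω₂ lam β γ).hamiltonian N x)) *
        wienerPair S ^ (1 / Real.conjExponent p) := by
  set P := pinnedChain ω₂ lam β γ with hP
  have hpq := Real.HolderConjugate.conjExponent hp
  set q := Real.conjExponent p with hq
  set f : WienerPair → ℝ≥0∞ := fun ω => ENNReal.ofReal (Real.exp (θ * P.hamiltonian N (P.solMap N T_L T_R t x (pairPath ω)))) with hf
  have hfm : Measurable f := ENNReal.measurable_ofReal.comp (Real.measurable_exp.comp
    (((pinnedChain_continuous_hamiltonian ω₂ lam β γ N).measurable.comp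
      (pinnedChain_measurable_solMap_pairPath_right hω hl hβ hγ N T_L T_R t x)).const_mul _))
  have hgm : Measurable (S.indicator (1 : WienerPair → ℝ≥0∞)) := measurable_one.indicator hS
  have hH := ENNReal.lintegral_mul_le_Lp_mul_Lq wienerPair hpq hfm.aemeasurable hgm.aemeasurable
  have hcomm : ∀ ω, S.indicator (1 : WienerPair → ℝ≥0∞) ω *
      ENNReal.ofReal (Real.exp (θ * P.hamiltonian N (P.solMap N T_L T_R t x (pairPath ω)))) =
      (f * S.indicator (1 : WienerPair → ℝ≥0∞)) ω := fun ω => by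
    simp only [Pi.mul_apply, hf]; rw [mul_comm]
  simp_rw [hcomm]
  refine hH.trans ?_
  -- the `p`-th moment by (3.4) at the exponent `pθ`
  have hp0 : 0 < p := by linarith
  have hfp : ∀ ω, f ω ^ p = ENNReal.ofReal (Real.exp ((p * θ) * P.hamiltonian N (P.solMap N T_L T_R t x (pairPath ω)))) := by
    intro ω
    simp only [hf]
    rw [ENNReal.ofReal_rpow_of_pos (Real.exp_pos _), ← Real.exp_mul]
    congr 2; ring
  have hmom : (∫⁻ ω, f ω ^ p ∂wienerPair) ^ (1 / p) ≤
      ENNReal.ofReal (Real.exp (θ * γ * (T_L + T_R) * t) * Real.exp (θ * P.hamiltonian N x)) := by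
    simp_rw [hfp]
    have h34 := pinnedChain_lintegral_exp_hamiltonian_solMap_le hω hl hβ hγ hN hTL hTR (θ := p * θ) (by positivity) hpθ t x
    calc (∫⁻ ω, ENNReal.ofReal (Real.exp ((p * θ) * P.hamiltonian N (P.solMap N T_L T_R t x (pairPath ω)))) ∂wienerPair) ^ (1 / p)
        ≤ (ENNReal.ofReal (Real.exp (p * θ * γ * (T_L + T_R) * t) * Real.exp (p * θ * P.hamiltonian N x))) ^ (1 / p) :=
          ENNReal.rpow_le_rpow h34 (by positivity)
      _ = _ := by
          rw [ENNReal.ofReal_rpow_of_nonneg (by positivity) (by positivity), ← Real.exp_add, ← Real.exp_mul,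
            ← Real.exp_add]
          congr 2
          field_simp
  -- the indicator
  have hind : ∫⁻ ω, S.indicator (1 : WienerPair → ℝ≥0∞) ω ^ q ∂wienerPair = wienerPair S := by
    have : ∀ ω, S.indicator (1 : WienerPair → ℝ≥0∞) ω ^ q = S.indicator 1 ω := fun ω => by
      by_cases hω : ω ∈ S
      · simp [hω]
      · simp [hω, ENNReal.zero_rpow_of_pos hpq.symm.pos]
    simp_rw [this]
    rw [lintegral_indicator_one hS]
  rw [hind]
  gcongr

end Estimates

/-! ### Elementary asymptotics for the final bookkeeping -/

section Asymptotics

/-- `(c a + 1) e^{-k a⁴} → 0` as `a → ∞` (`c ≥ 0`, `k > 0`). [folklore] -/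
theorem tendsto_linear_mul_exp_neg_pow_four {c k : ℝ} (hc : 0 ≤ c) (hk : 0 < k) :
    Tendsto (fun a : ℝ => (c * a + 1) * Real.exp (-(k * a ^ 4))) atTop (𝓝 0) := by
  -- compare with `(c + 1)/k · (k a) e^{-k a}` for `a ≥ 1`
  have h1 : Tendsto (fun a : ℝ => (k * a) ^ 1 * Real.exp (-(k * a))) atTop (𝓝 0) :=
    (Real.tendsto_pow_mul_exp_neg_atTop_nhds_zero 1).comp (tendsto_id.const_mul_atTop hk)
  have h2 : Tendsto (fun a : ℝ => (c + 1) / k * ((k * a) ^ 1 * Real.exp (-(k * a)))) atTop (𝓝 0) := by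
    simpa using h1.const_mul ((c + 1) / k)
  refine tendsto_of_tendsto_of_tendsto_of_le_of_le' tendsto_const_nhds h2 ?_ ?_
  · filter_upwards [eventually_ge_atTop 0] with a ha
    exact mul_nonneg (by positivity) (Real.exp_pos _).le
  · filter_upwards [eventually_ge_atTop 1] with a ha
    have hexp : Real.exp (-(k * a ^ 4)) ≤ Real.exp (-(k * a)) := by
      refine Real.exp_le_exp.2 (neg_le_neg (mul_le_mul_of_nonneg_left ?_ hk.le))
      calc a = a ^ 1 := (pow_one a).symm
        _ ≤ a ^ 4 := pow_le_pow_right₀ ha (by norm_num)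
    have hlin : c * a + 1 ≤ (c + 1) * a := by nlinarith
    calc (c * a + 1) * Real.exp (-(k * a ^ 4)) ≤ ((c + 1) * a) * Real.exp (-(k * a)) :=
          mul_le_mul hlin hexp (Real.exp_pos _).le (by positivity)
      _ = (c + 1) / k * ((k * a) ^ 1 * Real.exp (-(k * a))) := by
          field_simp

/-- `c/aⁿ → 0` as `a → ∞` (`n ≥ 1`). [folklore] -/
theorem tendsto_const_mul_inv_pow (c : ℝ) {n : ℕ} (hn : n ≠ 0) :
    Tendsto (fun a : ℝ => c * (a ^ n)⁻¹) atTop (𝓝 0) := by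
  have h := (tendsto_inv_atTop_zero.comp (tendsto_pow_atTop hn)).const_mul c
  simpa using h

end Asymptotics

/-! ### The dissipation over the whole grid on good paths (Corollary 5.4, here sure) -/

section GridDissipation

variable {ω₂ lam β γ : ℝ} (hω : 0 < ω₂) (hl : 0 ≤ lam) (hβ : 0 ≤ β) (hγ : 0 ≤ γ) {N : ℕ} (hN : 1 < N)
  (T_L T_R : ℝ)
include hω hl hβ hγ hN

/-- **Corollary 5.4 on the deterministic grid**: if every grid energy `H(z_{jτ})`, `j ≤ J`, lies in
`[a⁴/2, 3a⁴/2]` and every noise increment over a cell is good (`θ_{jτ}ω ∈ goodPaths m' τ` with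
`c_max m' ≤ m₀ a ≤ δ₀ a²`), then the dissipation over `[0, Jτ]` is at least `J · γ ε₁ a⁴ τ` — each cell
satisfies the hypotheses of the deterministic core of Prop. 5.3 (`hF5`, from
`LangevinChainDissipation.lean`) thanks to the cell energy bound (`hcell`).
[cite: CuneoEckmannHairerReyBellet2018, Cor 5.4] -/
theorem pinnedChain_grid_dissipation_ge {Λ₀ ε₁ δ₀ a₀ m₀ a₁ : ℝ}
    (hF5 : ∀ ⦃a : ℝ⦄, a₀ ≤ a → ∀ ⦃τ : ℝ⦄, Λ₀ / a ≤ τ → τ ≤ 2 * Λ₀ / a →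
      ∀ x : PhaseSpace N, a ^ 4 / 2 ≤ (pinnedChain ω₂ lam β γ).hamiltonian N x →
        (pinnedChain ω₂ lam β γ).hamiltonian N x ≤ 2 * a ^ 4 →
        ∀ ⦃η : ℝ → Fin N → ℝ⦄, Continuous η → η 0 = 0 → (∀ s ∈ Icc 0 τ, ‖η s‖ ≤ δ₀ * a ^ 2) →
          (∀ s ∈ Icc 0 τ, (pinnedChain ω₂ lam β γ).hamiltonian N
            ((pinnedChain ω₂ lam β γ).chainFlow N x η s) ≤ 4 * a ^ 4) →
            γ * (ε₁ * a ^ 4 * τ) ≤ (pinnedChain ω₂ lam β γ).dissipation N x η τ)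
    (hcell : ∀ ⦃a : ℝ⦄, a₁ ≤ a → ∀ ⦃τ : ℝ⦄, 0 ≤ τ → τ ≤ 2 * Λ₀ / a →
      ∀ x : PhaseSpace N, (pinnedChain ω₂ lam β γ).hamiltonian N x ≤ 3 * a ^ 4 / 2 →
        ∀ ⦃η : ℝ → Fin N → ℝ⦄, Continuous η → (∀ s ∈ Icc 0 τ, ‖η s‖ ≤ m₀ * a) →
          ∀ s ∈ Icc 0 τ, (pinnedChain ω₂ lam β γ).hamiltonian N ((pinnedChain ω₂ lam β γ).chainFlow N x η s) ≤ 2 * a ^ 4)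
    {a τ m' : ℝ} (ha0 : a₀ ≤ a) (ha1 : a₁ ≤ a) (hτ0 : 0 ≤ τ) (hτ1 : Λ₀ / a ≤ τ) (hτ2 : τ ≤ 2 * Λ₀ / a)
    (hm' : 0 ≤ m')
    (hnoise : max (Real.sqrt (2 * γ * T_L)) (Real.sqrt (2 * γ * T_R)) * m' ≤ m₀ * a)
    (hnoise2 : m₀ * a ≤ δ₀ * a ^ 2) (x : PhaseSpace N) (J : ℕ) (ω : WienerPair)
    (hgrid : ∀ j : ℕ, j < J → a ^ 4 / 2 ≤ (pinnedChain ω₂ lam β γ).hamiltonian N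
        ((pinnedChain ω₂ lam β γ).solMap N T_L T_R (j * τ) x (pairPath ω)) ∧
      (pinnedChain ω₂ lam β γ).hamiltonian N ((pinnedChain ω₂ lam β γ).solMap N T_L T_R (j * τ) x (pairPath ω)) ≤ 3 * a ^ 4 / 2)
    (hgood : ∀ j : ℕ, j < J → pairShift ((j : ℝ) * τ).toNNReal ω ∈ goodPaths m' τ.toNNReal) :
    (J : ℝ) * (γ * (ε₁ * a ^ 4 * τ)) ≤
      (pinnedChain ω₂ lam β γ).dissipation N x ((pinnedChain ω₂ lam β γ).pairNoise N T_L T_R (pairPath ω)) (J * τ) := by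
  set P := pinnedChain ω₂ lam β γ with hP
  rw [pinnedChain_dissipation_grid hω hl hβ hγ N T_L T_R x hτ0 ω J]
  have hcellJ : ∀ j ∈ range J, γ * (ε₁ * a ^ 4 * τ) ≤ P.dissipation N (P.solMap N T_L T_R (j * τ) x (pairPath ω))
      (P.pairNoise N T_L T_R (pairShift ((j : ℝ) * τ).toNNReal ω)) τ := by
    intro j hj
    have hj' := mem_range.1 hj
    obtain ⟨hg1, hg2⟩ := hgrid j hj'
    set z := P.solMap N T_L T_R (j * τ) x (pairPath ω) with hz
    set η := P.pairNoise N T_L T_R (pairShift ((j : ℝ) * τ).toNNReal ω) with hη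
    have hηc : Continuous η := P.continuous_pairNoise N T_L T_R _
    have hη0 : η 0 = 0 := P.pairNoise_zero N T_L T_R _
    have hηb : ∀ s ∈ Icc 0 τ, ‖η s‖ ≤ m₀ * a := fun s hs => by
      have h := norm_pairNoise_pairShift_le P hN T_L T_R hm' (hgood j hj') hs.1
        (by rw [Real.coe_toNNReal']; exact le_max_of_le_left hs.2)
      exact h.trans hnoise
    have hηb' : ∀ s ∈ Icc 0 τ, ‖η s‖ ≤ δ₀ * a ^ 2 := fun s hs => (hηb s hs).trans hnoise2
    have ha4 : 0 ≤ a ^ 4 := by positivity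
    have hE : ∀ s ∈ Icc 0 τ, P.hamiltonian N (P.chainFlow N z η s) ≤ 4 * a ^ 4 := fun s hs => by
      have := hcell ha1 hτ0 hτ2 z hg2 hηc hηb s hs
      linarith only [this, ha4]
    have hg2' : P.hamiltonian N z ≤ 2 * a ^ 4 := by linarith only [hg2, ha4]
    exact hF5 ha0 hτ1 hτ2 z hg1 hg2' hηc hη0 hηb' hE
  have h := Finset.card_nsmul_le_sum (range J) _ _ hcellJ
  rwa [card_range, nsmul_eq_mul] at h

end GridDissipation

/-! ### The high-energy estimate: `E_z e^{θH(z_{t*}) - θH(z)} → 0` -/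

section Main

variable {ω₂ lam β γ : ℝ} (hω : 0 < ω₂) (hl : 0 < lam) (hβ : 0 < β) (hγ : 0 < γ) {N : ℕ} (hN : 1 < N)
  {T_L T_R : ℝ} (hTL : 0 < T_L) (hTR : 0 < T_R) {θ : ℝ} (hθ : 0 < θ) (hθ' : θ < 1 / max T_L T_R)
include hω hl hβ hγ hN hTL hTR hθ hθ'

-- the flow is a limit of Picard iterations: never let the unifier unfold it (heartbeats)
attribute [local irreducible] OscillatorChain.chainFlow

/-- **CEHR Theorem 5.1, qualitative form, for the pinned chain** (`ω₂, lam, β, γ > 0`, `N ≥ 2`,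
`T_L, T_R > 0`, `0 < θ < 1/T_max`, `t* > 0`): there is `E₀` such that for every start `z` with
`H(z) ≥ E₀`, `E_z e^{θH(z_{t*})} ≤ ½ e^{θH(z)}` (the printed (5.1) gives the rate `e^{-C₁H(z)}`; the
decay to `0` of `E_z e^{θH(z_{t*}) - θH(z)}` is all that Remark 5.2 uses). Proof: the grid
decomposition described in the module docstring.
[cite: CuneoEckmannHairerReyBellet2018, Thm 5.1] -/
theorem pinnedChain_lintegral_exp_hamiltonian_small {tstar : ℝ} (hts : 0 < tstar) :
    ∃ E₀ : ℝ, ∀ x : PhaseSpace N, E₀ ≤ (pinnedChain ω₂ lam β γ).hamiltonian N x →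
      ∫⁻ ω, ENNReal.ofReal (Real.exp (θ * (pinnedChain ω₂ lam β γ).hamiltonian N
          ((pinnedChain ω₂ lam β γ).solMap N T_L T_R tstar x (pairPath ω)))) ∂wienerPair ≤
        ENNReal.ofReal (Real.exp (θ * (pinnedChain ω₂ lam β γ).hamiltonian N x) / 2) := by
  set P := pinnedChain ω₂ lam β γ with hP
  have hN0 : 0 < N := by omega
  have hTm : 0 < max T_L T_R := lt_max_of_lt_left hTL
  have hθT : θ * max T_L T_R < 1 := (lt_div_iff₀ hTm).1 hθ'
  -- constants of the estimate
  set κ : ℝ := θ * (1 - θ * max T_L T_R) with hκ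
  have hκ0 : 0 < κ := mul_pos hθ (by linarith only [hθT])
  set Cst : ℝ := θ * γ * (T_L + T_R) with hCst
  have hCst0 : 0 ≤ Cst := by positivity
  -- the Hölder exponent: `1 < p`, `pθ < 1/T_max`
  set p : ℝ := (1 + 1 / (θ * max T_L T_R)) / 2 with hp
  have hθT0 : 0 < θ * max T_L T_R := by positivity
  have hp1 : 1 < p := by
    rw [hp]
    have : 1 < 1 / (θ * max T_L T_R) := by rw [lt_div_iff₀ hθT0]; linarith only [hθT]
    linarith only [this]
  have hpθ : p * θ < 1 / max T_L T_R := by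
    rw [lt_div_iff₀ hTm, hp]
    have h1 : (1 + 1 / (θ * max T_L T_R)) / 2 * θ * max T_L T_R = (θ * max T_L T_R + 1) / 2 := by
      field_simp
    calc (1 + 1 / (θ * max T_L T_R)) / 2 * θ * max T_L T_R = (θ * max T_L T_R + 1) / 2 := h1
      _ < 1 := by linarith only [hθT]
  have hpq := Real.HolderConjugate.conjExponent hp1
  set q := Real.conjExponent p with hq
  have hq0 : 0 < 1 / q := by have := hpq.symm.pos; positivity
  -- the deterministic inputs
  obtain ⟨Λ₀, ε₁, δ₀, a₀, hΛ₀, hε₁, hδ₀, ha₀, hF5⟩ := pinnedChain_dissipation_lower_bound hω hl hβ hγ.le hN0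
  obtain ⟨m₀, a₁, hm₀, ha₁, hcell⟩ := pinnedChain_cell_energy_le hω hl.le hβ.le hγ.le N hΛ₀
  set cmax : ℝ := max (Real.sqrt (2 * γ * T_L)) (Real.sqrt (2 * γ * T_R)) with hcmax
  have hcmax0 : 0 ≤ cmax := le_max_of_le_left (Real.sqrt_nonneg _)
  set m₁ : ℝ := m₀ / (cmax + 1) with hm₁
  have hm₁0 : 0 < m₁ := by positivity
  have hm₁le : cmax * m₁ ≤ m₀ := by
    rw [hm₁, mul_div_assoc']
    rw [div_le_iff₀ (by positivity)]
    nlinarith only [hcmax0, hm₀]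
  -- the bound function and its decay
  set Bf : ℝ → ℝ := fun a => Real.exp (Cst * tstar) * Real.exp (-(κ * γ * ε₁ * tstar * a ^ 4)) +
      (tstar / Λ₀ * a + 1) * Real.exp (Cst * tstar) * Real.exp (-(θ / 2 * a ^ 4)) +
      Real.exp (Cst * tstar) * ((tstar / Λ₀ * a + 1) * Real.exp (Cst * tstar) * Real.exp (-(θ / 2 * a ^ 4)) +
        (64 * Λ₀ * tstar / m₁ ^ 4) * (a ^ 5)⁻¹) ^ (1 / q) with hBf
  have hBf0 : Tendsto Bf atTop (𝓝 0) := by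
    have h1 : Tendsto (fun a : ℝ => Real.exp (Cst * tstar) * Real.exp (-(κ * γ * ε₁ * tstar * a ^ 4))) atTop (𝓝 0) := by
      have := (tendsto_linear_mul_exp_neg_pow_four (c := 0) le_rfl (k := κ * γ * ε₁ * tstar) (by positivity)).const_mul
        (Real.exp (Cst * tstar))
      simpa using this
    have h2 : Tendsto (fun a : ℝ => (tstar / Λ₀ * a + 1) * Real.exp (Cst * tstar) * Real.exp (-(θ / 2 * a ^ 4))) atTop (𝓝 0) := by
      have := (tendsto_linear_mul_exp_neg_pow_four (c := tstar / Λ₀) (by positivity) (k := θ / 2) (by positivity)).const_mul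
        (Real.exp (Cst * tstar))
      rw [mul_zero] at this
      refine this.congr fun a => ?_
      ring
    have h3 : Tendsto (fun a : ℝ => (64 * Λ₀ * tstar / m₁ ^ 4) * (a ^ 5)⁻¹) atTop (𝓝 0) :=
      tendsto_const_mul_inv_pow _ (by norm_num)
    have h4 := ((h2.add h3).rpow_const (Or.inr hq0.le)).const_mul (Real.exp (Cst * tstar))
    rw [add_zero, Real.zero_rpow hq0.ne', mul_zero] at h4
    have := (h1.add h2).add h4
    simpa only [add_zero] using this
  -- thresholds
  have hev : ∀ᶠ a : ℝ in atTop, Bf a < 1 / 2 ∧ max a₀ a₁ ≤ a ∧ 2 * Λ₀ / tstar ≤ a ∧ m₀ / δ₀ ≤ a ∧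
      4 * Λ₀ / m₁ ^ 2 + 1 ≤ a ∧ 1 ≤ a := by
    refine ((tendsto_order.1 hBf0).2 _ (by norm_num)).and ((eventually_ge_atTop _).and
      ((eventually_ge_atTop _).and ((eventually_ge_atTop _).and ((eventually_ge_atTop _).and (eventually_ge_atTop _)))))
  obtain ⟨A, hA⟩ := Filter.eventually_atTop.1 hev
  set A' : ℝ := max A 1 with hA'
  have hA'1 : 1 ≤ A' := le_max_right _ _
  refine ⟨A' ^ 4, fun x hx => ?_⟩
  ----------------------------------------------------------------
  -- Step 1: the scale `a = H(x)^{1/4}` and the grid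
  ----------------------------------------------------------------
  set E : ℝ := P.hamiltonian N x with hE
  have hE0 : 0 ≤ E := le_trans (by positivity) hx
  set a : ℝ := Real.sqrt (Real.sqrt E) with ha
  have ha_nonneg : 0 ≤ a := Real.sqrt_nonneg _
  have ha4 : a ^ 4 = E := by
    rw [ha, show (4 : ℕ) = 2 * 2 from rfl, pow_mul, Real.sq_sqrt (Real.sqrt_nonneg _), Real.sq_sqrt hE0]
  have haA' : A' ≤ a := by
    have h1 : Real.sqrt (Real.sqrt (A' ^ 4)) = A' := by
      rw [show A' ^ 4 = (A' ^ 2) ^ 2 by ring, Real.sqrt_sq (by positivity), Real.sqrt_sq (by positivity)]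
    rw [← h1, ha]
    exact Real.sqrt_le_sqrt (Real.sqrt_le_sqrt hx)
  obtain ⟨hBa, hmaxa, hΛa, hmδa, hΛm, ha1⟩ := hA a ((le_max_left _ _).trans haA')
  have ha0 : 0 < a := by linarith only [ha1]
  have haa₀ : a₀ ≤ a := (le_max_left _ _).trans hmaxa
  have haa₁ : a₁ ≤ a := (le_max_right _ _).trans hmaxa
  -- the grid: `J = ⌊t* a / Λ₀⌋`, `τ = t*/J ∈ [Λ₀/a, 2Λ₀/a]`, `Jτ = t*`
  set r : ℝ := tstar * a / Λ₀ with hr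
  have hr2 : 2 ≤ r := by
    rw [hr, le_div_iff₀ hΛ₀]
    have := (div_le_iff₀ hts).1 hΛa
    nlinarith only [this, hts.le]
  set J : ℕ := ⌊r⌋₊ with hJ
  have hJle : (J : ℝ) ≤ r := Nat.floor_le (by linarith only [hr2])
  have hJlt : r < J + 1 := Nat.lt_floor_add_one r
  have hJ1 : (1 : ℝ) ≤ J := by
    have : (1 : ℝ) < J := by linarith only [hr2, hJlt]
    exact this.le
  have hJpos : (0 : ℝ) < J := by linarith only [hJ1]
  have hJne : (J : ℝ) ≠ 0 := hJpos.ne'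
  set τ : ℝ := tstar / J with hτ
  have hτ0 : 0 < τ := div_pos hts hJpos
  have hJτ : (J : ℝ) * τ = tstar := by rw [hτ]; field_simp
  have hτ1 : Λ₀ / a ≤ τ := by
    rw [hτ, div_le_div_iff₀ ha0 hJpos]
    have : (J : ℝ) * Λ₀ ≤ tstar * a := by
      have := hJle; rw [hr, le_div_iff₀ hΛ₀] at this; linarith only [this]
    linarith only [this]
  have hτ2 : τ ≤ 2 * Λ₀ / a := by
    rw [hτ, div_le_div_iff₀ hJpos ha0]
    have : tstar * a ≤ 2 * Λ₀ * J := by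
      have h2J : r ≤ 2 * J := by linarith only [hJlt, hJ1]
      rw [hr, div_le_iff₀ hΛ₀] at h2J; linarith only [h2J]
    linarith only [this]
  have hτt : τ ≤ tstar := by
    rw [hτ, div_le_iff₀ hJpos]; nlinarith only [hJ1, hts.le]
  have hjτ : ∀ j : ℕ, j < J + 1 → (j : ℝ) * τ ≤ tstar := fun j hj => by
    have : (j : ℝ) ≤ J := by exact_mod_cast Nat.lt_succ_iff.1 hj
    calc (j : ℝ) * τ ≤ J * τ := mul_le_mul_of_nonneg_right this hτ0.le
      _ = tstar := hJτ
  -- small-noise thresholds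
  have hnoise2 : m₀ * a ≤ δ₀ * a ^ 2 := by
    have : m₀ ≤ δ₀ * a := by rw [div_le_iff₀ hδ₀] at hmδa; linarith only [hmδa]
    nlinarith only [this, ha0.le]
  have hnoise : cmax * (m₁ * a) ≤ m₀ * a := by
    rw [← mul_assoc]; exact mul_le_mul_of_nonneg_right hm₁le ha0.le
  have hm'0 : 0 ≤ m₁ * a := by positivity
  have hτsmall : τ ≤ (m₁ * a) ^ 2 / 2 := by
    refine hτ2.trans ?_
    rw [div_le_div_iff₀ ha0 (by norm_num : (0:ℝ) < 2)]
    have h3 : 4 * Λ₀ / m₁ ^ 2 < a := by linarith only [hΛm]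
    rw [div_lt_iff₀ (by positivity)] at h3
    have ha3 : a ≤ a ^ 3 := le_self_pow₀ ha1 (by norm_num)
    nlinarith only [h3, ha3, hΛ₀.le, hm₁0]
  ----------------------------------------------------------------
  -- Step 2: the events
  ----------------------------------------------------------------
  set H := P.hamiltonian N with hH
  have hHm : Measurable H := (pinnedChain_continuous_hamiltonian ω₂ lam β γ N).measurable
  set z : ℕ → WienerPair → PhaseSpace N := fun j ω => P.solMap N T_L T_R (j * τ) x (pairPath ω) with hz
  have hzm : ∀ j, Measurable (z j) := fun j => pinnedChain_measurable_solMap_pairPath_right hω hl.le hβ.le hγ.le N T_L T_R _ x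
  set F : WienerPair → ℝ≥0∞ := fun ω => ENNReal.ofReal (Real.exp (θ * H (P.solMap N T_L T_R tstar x (pairPath ω)))) with hF
  have hFm : Measurable F := ENNReal.measurable_ofReal.comp (Real.measurable_exp.comp
    ((hHm.comp (pinnedChain_measurable_solMap_pairPath_right hω hl.le hβ.le hγ.le N T_L T_R tstar x)).const_mul _))
  set Γ : WienerPair → ℝ := fun ω => P.dissipation N x (P.pairNoise N T_L T_R (pairPath ω)) tstar with hΓ
  have hΓm : Measurable Γ := pinnedChain_measurable_dissipation_pairPath hω hl.le hβ.le hγ.le N tstar x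
  set g : ℝ := γ * ε₁ * tstar * E with hg
  set SΓ : Set WienerPair := {ω | g ≤ Γ ω} with hSΓ
  have hSΓm : MeasurableSet SΓ := measurableSet_le measurable_const hΓm
  set D : ℕ → Set WienerPair := fun j => {ω | H (z j ω) < E / 2} with hD
  have hDm : ∀ j, MeasurableSet (D j) := fun j => measurableSet_lt (hHm.comp (hzm j)) measurable_const
  set U : ℕ → Set WienerPair := fun j => {ω | 3 * E / 2 < H (z j ω)} with hU
  have hUm : ∀ j, MeasurableSet (U j) := fun j => measurableSet_lt measurable_const (hHm.comp (hzm j))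
  set Nb : ℕ → Set WienerPair := fun j => {ω | pairShift ((j : ℝ) * τ).toNNReal ω ∉ goodPaths (m₁ * a) τ.toNNReal} with hNb
  have hNbm : ∀ j, MeasurableSet (Nb j) := fun j =>
    ((measurable_pairShift (s := ((j : ℝ) * τ).toNNReal)) (measurableSet_goodPaths (m₁ * a) τ.toNNReal)).compl
  set S₃ : Set WienerPair := (⋃ j ∈ range (J + 1), U j) ∪ (⋃ j ∈ range J, Nb j) with hS₃
  have hS₃m : MeasurableSet S₃ := (Finset.measurableSet_biUnion _ fun j _ => hUm j).union
    (Finset.measurableSet_biUnion _ fun j _ => hNbm j)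
  ----------------------------------------------------------------
  -- Step 3: off `S₃` and the `D_j`, the dissipation is at least `g` (Cor. 5.4, sure)
  ----------------------------------------------------------------
  have hcover : ∀ ω, ω ∉ S₃ → (∀ j ∈ range (J + 1), ω ∉ D j) → ω ∈ SΓ := by
    intro ω h3 hD'
    simp only [hS₃, Set.mem_union, Set.mem_iUnion, not_or, not_exists, exists_prop, not_and] at h3
    obtain ⟨hU', hNb'⟩ := h3
    have hgrid : ∀ j : ℕ, j < J → a ^ 4 / 2 ≤ P.hamiltonian N (P.solMap N T_L T_R (j * τ) x (pairPath ω)) ∧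
        P.hamiltonian N (P.solMap N T_L T_R (j * τ) x (pairPath ω)) ≤ 3 * a ^ 4 / 2 := by
      intro j hj
      have hj' : j ∈ range (J + 1) := mem_range.2 (by omega)
      have h1 := hD' j hj'
      have h2 := hU' j hj'
      simp only [hD, hU, hz, Set.mem_setOf_eq, not_lt] at h1 h2
      rw [ha4]
      exact ⟨by linarith only [h1], by linarith only [h2]⟩
    have hgood : ∀ j : ℕ, j < J → pairShift ((j : ℝ) * τ).toNNReal ω ∈ goodPaths (m₁ * a) τ.toNNReal := by
      intro j hj
      have := hNb' j (mem_range.2 hj)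
      simpa only [hNb, Set.mem_setOf_eq, not_not] using this
    have hdis := pinnedChain_grid_dissipation_ge hω hl.le hβ.le hγ.le hN T_L T_R hF5 hcell haa₀ haa₁ hτ0.le hτ1 hτ2
      hm'0 hnoise hnoise2 x J ω hgrid hgood
    rw [hJτ] at hdis
    show g ≤ Γ ω
    calc g = (J : ℝ) * (γ * (ε₁ * a ^ 4 * τ)) := by
          rw [hg, ← ha4, ← hJτ]; ring
      _ ≤ Γ ω := hdis
  -- pointwise domination of `F`
  have hdom : ∀ ω, F ω ≤ SΓ.indicator F ω + (∑ j ∈ range (J + 1), (D j).indicator F ω) + S₃.indicator F ω := by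
    intro ω
    by_cases h3 : ω ∈ S₃
    · rw [Set.indicator_of_mem h3]
      exact le_add_self
    · by_cases hD' : ∃ j ∈ range (J + 1), ω ∈ D j
      · obtain ⟨j, hj, hωj⟩ := hD'
        have : F ω ≤ ∑ j ∈ range (J + 1), (D j).indicator F ω := by
          calc F ω = (D j).indicator F ω := (Set.indicator_of_mem hωj F).symm
            _ ≤ ∑ j ∈ range (J + 1), (D j).indicator F ω :=
                Finset.single_le_sum (f := fun j => (D j).indicator F ω) (fun _ _ => bot_le) hj
        exact this.trans (le_add_left le_rfl |>.trans (le_add_right le_rfl))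
      · push Not at hD'
        rw [Set.indicator_of_mem (hcover ω h3 hD')]
        exact le_add_right (le_add_right le_rfl)
  ----------------------------------------------------------------
  -- Step 4: the three integral bounds
  ----------------------------------------------------------------
  -- (T1) large dissipation: the exponential supermartingale (Lemma 5.5)
  have hT1 : ∫⁻ ω, SΓ.indicator F ω ∂wienerPair ≤
      ENNReal.ofReal (Real.exp (-(κ * g)) * Real.exp (θ * E + Cst * tstar)) := by
    have hpt : ∀ ω, SΓ.indicator F ω ≤ ENNReal.ofReal (Real.exp (-(κ * g))) *
        ENNReal.ofReal (Real.exp (θ * H (P.solMap N T_L T_R tstar x (pairPath ω)) + κ * Γ ω)) := by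
      intro ω
      by_cases hω : ω ∈ SΓ
      · rw [Set.indicator_of_mem hω, hF, ← ENNReal.ofReal_mul (Real.exp_pos _).le, ← Real.exp_add]
        refine ENNReal.ofReal_le_ofReal (Real.exp_le_exp.2 ?_)
        have : g ≤ Γ ω := hω
        nlinarith only [this, hκ0]
      · rw [Set.indicator_of_notMem hω]; exact bot_le
    refine (lintegral_mono hpt).trans ?_
    have hm2 : Measurable fun ω => ENNReal.ofReal (Real.exp (θ * H (P.solMap N T_L T_R tstar x (pairPath ω)) + κ * Γ ω)) :=
      ENNReal.measurable_ofReal.comp (Real.measurable_exp.comp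
        (((hHm.comp (pinnedChain_measurable_solMap_pairPath_right hω hl.le hβ.le hγ.le N T_L T_R tstar x)).const_mul _).add
          (hΓm.const_mul _)))
    rw [lintegral_const_mul _ hm2, ENNReal.ofReal_mul (Real.exp_pos _).le]
    gcongr
    have h := pinnedChain_lintegral_exp_hamiltonian_add_dissipation_le hω hl.le hβ.le hγ.le N hTL.le hTR.le hN θ hts.le x
    simpa only [hκ, hCst] using h
  -- (T2) low grid energy: restart and (3.4)
  have hT2 : ∀ j ∈ range (J + 1), ∫⁻ ω, (D j).indicator F ω ∂wienerPair ≤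
      ENNReal.ofReal (Real.exp (Cst * tstar) * Real.exp (θ * E / 2)) := by
    intro j hj
    have hj' := mem_range.1 hj
    set B : Set (PhaseSpace N) := {y | H y < E / 2} with hB
    have hBm : MeasurableSet B := measurableSet_lt hHm measurable_const
    have hind : ∀ ω, (D j).indicator F ω = B.indicator 1 (z j ω) * F ω := fun ω => by
      by_cases hω : ω ∈ D j
      · have : z j ω ∈ B := hω
        rw [Set.indicator_of_mem hω, Set.indicator_of_mem this, Pi.one_apply, one_mul]
      · have : z j ω ∉ B := hω
        rw [Set.indicator_of_notMem hω, Set.indicator_of_notMem this, zero_mul]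
    simp_rw [hind]
    have hu : 0 ≤ tstar - j * τ := by linarith only [hjτ j hj']
    have hsj : (((j : ℝ) * τ).toNNReal : ℝ) = j * τ := Real.coe_toNNReal _ (by positivity)
    have hR := pinnedChain_lintegral_indicator_exp_hamiltonian_restart_le hω hl.le hβ.le hγ.le hN0 hTL hTR hθ hθ'
      ((j : ℝ) * τ).toNNReal hu x hBm
    rw [hsj, show (j : ℝ) * τ + (tstar - j * τ) = tstar by ring] at hR
    refine hR.trans ?_
    have hpt : ∀ ω, B.indicator 1 (P.solMap N T_L T_R (j * τ) x (pairPath ω)) *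
        ENNReal.ofReal (Real.exp (θ * P.hamiltonian N (P.solMap N T_L T_R (j * τ) x (pairPath ω)))) ≤
        ENNReal.ofReal (Real.exp (θ * E / 2)) := by
      intro ω
      by_cases hω : P.solMap N T_L T_R (j * τ) x (pairPath ω) ∈ B
      · rw [Set.indicator_of_mem hω, Pi.one_apply, one_mul]
        refine ENNReal.ofReal_le_ofReal (Real.exp_le_exp.2 ?_)
        have : H (P.solMap N T_L T_R (j * τ) x (pairPath ω)) < E / 2 := hω
        nlinarith only [this, hθ]
      · rw [Set.indicator_of_notMem hω, zero_mul]; exact bot_le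
    calc ENNReal.ofReal (Real.exp (θ * γ * (T_L + T_R) * (tstar - j * τ))) *
          ∫⁻ ω, B.indicator 1 (P.solMap N T_L T_R (j * τ) x (pairPath ω)) *
            ENNReal.ofReal (Real.exp (θ * P.hamiltonian N (P.solMap N T_L T_R (j * τ) x (pairPath ω)))) ∂wienerPair
        ≤ ENNReal.ofReal (Real.exp (Cst * tstar)) * ∫⁻ _ω, ENNReal.ofReal (Real.exp (θ * E / 2)) ∂wienerPair := by
          refine mul_le_mul' (ENNReal.ofReal_le_ofReal (Real.exp_le_exp.2 ?_)) (lintegral_mono hpt)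
          rw [hCst]
          have : tstar - j * τ ≤ tstar := by
            have : (0 : ℝ) ≤ j * τ := by positivity
            linarith only [this]
          exact mul_le_mul_of_nonneg_left this hCst0
      _ = _ := by
          rw [lintegral_const, measure_univ, mul_one, ← ENNReal.ofReal_mul (Real.exp_pos _).le]
  -- (T3) the bad events: Hölder, Chebyshev and the Brownian tail
  have hU_le : ∀ j ∈ range (J + 1), wienerPair (U j) ≤
      ENNReal.ofReal (Real.exp (-(θ * (3 * E / 2))) * (Real.exp (Cst * tstar) * Real.exp (θ * E))) := by
    intro j hj
    have hj' := mem_range.1 hj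
    have hsj : (((j : ℝ) * τ).toNNReal : ℝ) = j * τ := Real.coe_toNNReal _ (by positivity)
    have h := pinnedChain_measure_lt_hamiltonian_solMap_le hω hl.le hβ.le hγ.le hN0 hTL hTR hθ hθ'
      ((j : ℝ) * τ).toNNReal x (3 * E / 2)
    rw [hsj] at h
    refine h.trans (ENNReal.ofReal_le_ofReal ?_)
    refine mul_le_mul_of_nonneg_left (mul_le_mul_of_nonneg_right (Real.exp_le_exp.2 ?_) (Real.exp_pos _).le) (Real.exp_pos _).le
    rw [hCst]
    exact mul_le_mul_of_nonneg_left (hjτ j hj') hCst0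
  have hNb_le : ∀ j ∈ range J, wienerPair (Nb j) ≤
      2 * ENNReal.ofReal (2 * τ ^ 2 / ((m₁ * a) ^ 2 - τ) ^ 2) := by
    intro j _
    have h := measure_pairShift_not_mem_goodPaths ((j : ℝ) * τ).toNNReal (m₁ * a) τ.toNNReal
    simp only [hNb]
    rw [h]
    have hτ' : ((τ.toNNReal : ℝ≥0) : ℝ) = τ := Real.coe_toNNReal τ hτ0.le
    have hlt : ((τ.toNNReal : ℝ≥0) : ℝ) < (m₁ * a) ^ 2 := by
      rw [hτ']
      have : 0 < (m₁ * a) ^ 2 := by positivity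
      linarith only [hτsmall, this]
    have := measure_compl_goodEvent_le hm'0 τ.toNNReal hlt
    rwa [hτ'] at this
  set u₁ : ℝ := Real.exp (-(θ * (3 * E / 2))) * (Real.exp (Cst * tstar) * Real.exp (θ * E)) with hu₁
  set u₂ : ℝ := 2 * τ ^ 2 / ((m₁ * a) ^ 2 - τ) ^ 2 with hu₂
  have hu₁0 : 0 ≤ u₁ := by positivity
  have hu₂0 : 0 ≤ u₂ := by positivity
  set Y : ℝ := (J + 1) * u₁ + J * (2 * u₂) with hY
  have hY0 : 0 ≤ Y := by positivity
  have hJ' : ENNReal.ofReal ((J : ℝ) + 1) = (J : ℝ≥0∞) + 1 := by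
    rw [ENNReal.ofReal_add (Nat.cast_nonneg J) zero_le_one, ENNReal.ofReal_natCast, ENNReal.ofReal_one]
  have hS₃_le : wienerPair S₃ ≤ ENNReal.ofReal Y := by
    calc wienerPair S₃ ≤ wienerPair (⋃ j ∈ range (J + 1), U j) + wienerPair (⋃ j ∈ range J, Nb j) :=
          measure_union_le _ _
      _ ≤ (∑ j ∈ range (J + 1), wienerPair (U j)) + ∑ j ∈ range J, wienerPair (Nb j) :=
          add_le_add (measure_biUnion_finset_le _ _) (measure_biUnion_finset_le _ _)
      _ ≤ (∑ j ∈ range (J + 1), ENNReal.ofReal u₁) + ∑ j ∈ range J, 2 * ENNReal.ofReal u₂ :=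
          add_le_add (Finset.sum_le_sum hU_le) (Finset.sum_le_sum hNb_le)
      _ = ENNReal.ofReal Y := by
          rw [Finset.sum_const, Finset.sum_const, card_range, card_range, nsmul_eq_mul, nsmul_eq_mul, hY,
            ENNReal.ofReal_add (by positivity : 0 ≤ ((J : ℝ) + 1) * u₁) (by positivity : 0 ≤ (J : ℝ) * (2 * u₂)),
            ENNReal.ofReal_mul (by positivity : 0 ≤ (J : ℝ) + 1), ENNReal.ofReal_mul (Nat.cast_nonneg J),
            ENNReal.ofReal_mul (by norm_num : (0 : ℝ) ≤ 2), ENNReal.ofReal_ofNat, ENNReal.ofReal_natCast, hJ']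
          push_cast
          rfl
  have hT3 : ∫⁻ ω, S₃.indicator F ω ∂wienerPair ≤
      ENNReal.ofReal (Real.exp (Cst * tstar) * Real.exp (θ * E)) * ENNReal.ofReal Y ^ (1 / q) := by
    have hind : ∀ ω, S₃.indicator F ω = S₃.indicator 1 ω * F ω := fun ω => by
      by_cases hω : ω ∈ S₃
      · rw [Set.indicator_of_mem hω, Set.indicator_of_mem hω, Pi.one_apply, one_mul]
      · rw [Set.indicator_of_notMem hω, Set.indicator_of_notMem hω, zero_mul]
    simp_rw [hind]
    have h := pinnedChain_lintegral_indicator_exp_hamiltonian_le_rpow hω hl.le hβ.le hγ.le hN0 hTL hTR hθ hp1 hpθ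
      tstar.toNNReal x hS₃m
    rw [Real.coe_toNNReal tstar hts.le] at h
    refine h.trans ?_
    rw [← hCst, ← hq]
    gcongr
  ----------------------------------------------------------------
  -- Step 5: assemble
  ----------------------------------------------------------------
  have hsum : ∫⁻ ω, F ω ∂wienerPair ≤
      ENNReal.ofReal (Real.exp (-(κ * g)) * Real.exp (θ * E + Cst * tstar)) +
      (J + 1) * ENNReal.ofReal (Real.exp (Cst * tstar) * Real.exp (θ * E / 2)) +
      ENNReal.ofReal (Real.exp (Cst * tstar) * Real.exp (θ * E)) * ENNReal.ofReal Y ^ (1 / q) := by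
    have hDsum_m : Measurable fun ω => ∑ j ∈ range (J + 1), (D j).indicator F ω :=
      Finset.measurable_sum _ fun j _ => hFm.indicator (hDm j)
    calc ∫⁻ ω, F ω ∂wienerPair
        ≤ ∫⁻ ω, (SΓ.indicator F ω + (∑ j ∈ range (J + 1), (D j).indicator F ω) + S₃.indicator F ω) ∂wienerPair :=
          lintegral_mono hdom
      _ = (∫⁻ ω, SΓ.indicator F ω ∂wienerPair) + (∑ j ∈ range (J + 1), ∫⁻ ω, (D j).indicator F ω ∂wienerPair) +
            ∫⁻ ω, S₃.indicator F ω ∂wienerPair := by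
          rw [lintegral_add_right _ (hFm.indicator hS₃m), lintegral_add_left (hFm.indicator hSΓm),
            lintegral_finsetSum _ fun j _ => hFm.indicator (hDm j)]
      _ ≤ _ := by
          refine add_le_add (add_le_add hT1 ?_) hT3
          calc ∑ j ∈ range (J + 1), ∫⁻ ω, (D j).indicator F ω ∂wienerPair
              ≤ ∑ j ∈ range (J + 1), ENNReal.ofReal (Real.exp (Cst * tstar) * Real.exp (θ * E / 2)) :=
                Finset.sum_le_sum hT2
            _ = _ := by rw [Finset.sum_const, card_range, nsmul_eq_mul]; push_cast; ring
  -- everything as one real number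
  set X₁ : ℝ := Real.exp (-(κ * g)) * Real.exp (θ * E + Cst * tstar) with hX₁
  set X₂ : ℝ := Real.exp (Cst * tstar) * Real.exp (θ * E / 2) with hX₂
  set X₃ : ℝ := Real.exp (Cst * tstar) * Real.exp (θ * E) with hX₃
  have hX₁0 : 0 ≤ X₁ := by rw [hX₁]; positivity
  have hX₂0 : 0 ≤ X₂ := by rw [hX₂]; positivity
  have hX₃0 : 0 ≤ X₃ := by rw [hX₃]; positivity
  have hreal : ENNReal.ofReal (X₁ + (J + 1) * X₂ + X₃ * Y ^ (1 / q)) =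
      ENNReal.ofReal X₁ + (J + 1) * ENNReal.ofReal X₂ + ENNReal.ofReal X₃ * ENNReal.ofReal Y ^ (1 / q) := by
    have h1 : 0 ≤ ((J : ℝ) + 1) * X₂ := by positivity
    have h2 : 0 ≤ X₃ * Y ^ (1 / q) := by positivity
    have h3 : 0 ≤ X₁ + ((J : ℝ) + 1) * X₂ := by positivity
    rw [ENNReal.ofReal_add h3 h2, ENNReal.ofReal_add hX₁0 h1, ENNReal.ofReal_mul (by positivity : 0 ≤ (J : ℝ) + 1),
      ENNReal.ofReal_mul hX₃0, ENNReal.ofReal_rpow_of_nonneg hY0 hq0.le, hJ']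
  ----------------------------------------------------------------
  -- Step 6: the real inequality `X₁ + (J+1)X₂ + X₃ Y^{1/q} ≤ e^{θE} Bf(a) ≤ e^{θE}/2`
  ----------------------------------------------------------------
  have hJr : (J : ℝ) ≤ tstar / Λ₀ * a := by rw [div_mul_eq_mul_div]; exact hJle
  have hEexp : Real.exp (θ * E) * Real.exp (-(θ / 2 * a ^ 4)) = Real.exp (θ * E / 2) := by
    rw [← Real.exp_add, ha4]; congr 1; ring
  have hterm1 : X₁ = Real.exp (θ * E) * (Real.exp (Cst * tstar) * Real.exp (-(κ * γ * ε₁ * tstar * a ^ 4))) := by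
    rw [hX₁, hg, ← ha4, Real.exp_add]
    have : -(κ * (γ * ε₁ * tstar * a ^ 4)) = -(κ * γ * ε₁ * tstar * a ^ 4) := by ring
    rw [this]; ring
  have hterm2 : (J + 1) * X₂ ≤ Real.exp (θ * E) * ((tstar / Λ₀ * a + 1) * Real.exp (Cst * tstar) * Real.exp (-(θ / 2 * a ^ 4))) := by
    rw [hX₂, ← hEexp]
    have h0 : 0 ≤ Real.exp (Cst * tstar) * (Real.exp (θ * E) * Real.exp (-(θ / 2 * a ^ 4))) := by positivity
    calc ((J : ℝ) + 1) * (Real.exp (Cst * tstar) * (Real.exp (θ * E) * Real.exp (-(θ / 2 * a ^ 4))))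
        ≤ (tstar / Λ₀ * a + 1) * (Real.exp (Cst * tstar) * (Real.exp (θ * E) * Real.exp (-(θ / 2 * a ^ 4)))) :=
          mul_le_mul_of_nonneg_right (by linarith only [hJr]) h0
      _ = _ := by ring
  have hu₂_le : u₂ ≤ 32 * Λ₀ ^ 2 / (m₁ ^ 4 * a ^ 6) := by
    rw [hu₂]
    have hden : (m₁ * a) ^ 2 / 2 ≤ (m₁ * a) ^ 2 - τ := by linarith only [hτsmall]
    have hden0 : 0 < (m₁ * a) ^ 2 / 2 := by positivity
    have h1 : 2 * τ ^ 2 / ((m₁ * a) ^ 2 - τ) ^ 2 ≤ 2 * τ ^ 2 / ((m₁ * a) ^ 2 / 2) ^ 2 := by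
      refine div_le_div_of_nonneg_left (by positivity) (by positivity) ?_
      exact pow_le_pow_left₀ hden0.le hden 2
    refine h1.trans ?_
    have hτ2' : τ ^ 2 ≤ (2 * Λ₀ / a) ^ 2 := pow_le_pow_left₀ hτ0.le hτ2 2
    rw [div_le_div_iff₀ (by positivity) (by positivity)]
    have : 2 * τ ^ 2 * (m₁ ^ 4 * a ^ 6) ≤ 2 * (2 * Λ₀ / a) ^ 2 * (m₁ ^ 4 * a ^ 6) :=
      mul_le_mul_of_nonneg_right (by linarith only [hτ2']) (by positivity)
    refine this.trans (le_of_eq ?_)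
    field_simp
    ring
  have hY_le : Y ≤ (tstar / Λ₀ * a + 1) * Real.exp (Cst * tstar) * Real.exp (-(θ / 2 * a ^ 4)) +
      (64 * Λ₀ * tstar / m₁ ^ 4) * (a ^ 5)⁻¹ := by
    rw [hY]
    refine add_le_add ?_ ?_
    · rw [hu₁]
      have he : Real.exp (-(θ * (3 * E / 2))) * (Real.exp (Cst * tstar) * Real.exp (θ * E)) =
          Real.exp (Cst * tstar) * Real.exp (-(θ / 2 * a ^ 4)) := by
        rw [← ha4, mul_comm, mul_assoc, ← Real.exp_add]; congr 1; ring_nf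
      rw [he]
      have h0 : 0 ≤ Real.exp (Cst * tstar) * Real.exp (-(θ / 2 * a ^ 4)) := by positivity
      calc ((J : ℝ) + 1) * (Real.exp (Cst * tstar) * Real.exp (-(θ / 2 * a ^ 4)))
          ≤ (tstar / Λ₀ * a + 1) * (Real.exp (Cst * tstar) * Real.exp (-(θ / 2 * a ^ 4))) :=
            mul_le_mul_of_nonneg_right (by linarith only [hJr]) h0
        _ = _ := by ring
    · calc (J : ℝ) * (2 * u₂) ≤ (tstar / Λ₀ * a) * (2 * (32 * Λ₀ ^ 2 / (m₁ ^ 4 * a ^ 6))) :=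
            mul_le_mul hJr (by linarith only [hu₂_le]) (by positivity) (by positivity)
        _ = (64 * Λ₀ * tstar / m₁ ^ 4) * (a ^ 5)⁻¹ := by field_simp; ring
  have hterm3 : X₃ * Y ^ (1 / q) ≤ Real.exp (θ * E) * (Real.exp (Cst * tstar) *
      ((tstar / Λ₀ * a + 1) * Real.exp (Cst * tstar) * Real.exp (-(θ / 2 * a ^ 4)) +
        (64 * Λ₀ * tstar / m₁ ^ 4) * (a ^ 5)⁻¹) ^ (1 / q)) := by
    rw [hX₃]
    have hrp := Real.rpow_le_rpow hY0 hY_le hq0.le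
    calc Real.exp (Cst * tstar) * Real.exp (θ * E) * Y ^ (1 / q)
        ≤ Real.exp (Cst * tstar) * Real.exp (θ * E) * ((tstar / Λ₀ * a + 1) * Real.exp (Cst * tstar) * Real.exp (-(θ / 2 * a ^ 4)) +
            (64 * Λ₀ * tstar / m₁ ^ 4) * (a ^ 5)⁻¹) ^ (1 / q) := mul_le_mul_of_nonneg_left hrp (by positivity)
      _ = _ := by ring
  have hfinal : X₁ + (J + 1) * X₂ + X₃ * Y ^ (1 / q) ≤ Real.exp (θ * E) * Bf a := by
    rw [hterm1, hBf]
    simp only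
    nlinarith only [hterm2, hterm3, Real.exp_pos (θ * E)]
  have hhalf : Real.exp (θ * E) * Bf a ≤ Real.exp (θ * E) / 2 := by
    have := hBa.le
    nlinarith only [this, Real.exp_pos (θ * E)]
  calc ∫⁻ ω, F ω ∂wienerPair ≤ _ := hsum
    _ = ENNReal.ofReal (X₁ + (J + 1) * X₂ + X₃ * Y ^ (1 / q)) := hreal.symm
    _ ≤ ENNReal.ofReal (Real.exp (θ * E) / 2) := ENNReal.ofReal_le_ofReal (hfinal.trans hhalf)

end Main

/-! ### Remark 5.2: the Lyapunov condition H2 for the constructed semigroup (`lam > 0`, `N ≥ 2`) -/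

section H2

variable {ω₂ lam β γ : ℝ} (hω : 0 < ω₂) (hl : 0 < lam) (hβ : 0 < β) (hγ : 0 < γ) {N : ℕ} (hN : 1 < N)
  {T_L T_R : ℝ} (hTL : 0 < T_L) (hTR : 0 < T_R)
include hω hl hβ hγ hN hTL hTR

/-- **CEHR Theorem 5.1 / Remark 5.2 (Condition H2) for the pinned anharmonic chain, PROVED** for the
transition kernels `OscillatorChain.transitionKernel` of the SDE (2.2) constructed in the tree
(`lam > 0`, i.e. degrees `ℓ_i = ℓ_p = 4`, and `N ≥ 2` sites): for every `0 < θ < 1/max(T_L,T_R)`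
and every `t* > 0` there are `κ ∈ (0,1)`, `c > 0` and a compact `K` with
`E_z e^{θH(z_{t*})} ≤ κ e^{θH(z)} + c 1_K(z)` for all `z` (`κ = 1/2`, `K = {H ≤ E₀}` with `E₀` from
`pinnedChain_lintegral_exp_hamiltonian_small`, `c = e^{θγ(T_L+T_R)t*} e^{θE₀}` from (3.4) on `K`). This
is the statement of the named fact `CuneoEckmannHairerReyBellet2018_H2` (`LangevinChainDynkin.lean`)
for these parameters. [cite: CuneoEckmannHairerReyBellet2018, Thm 5.1 and Rem 5.2] -/
theorem pinnedChain_H2_of_pos {θ : ℝ} (hθ : 0 < θ) (hθ' : θ < 1 / max T_L T_R) (tstar : ℝ≥0) (hts : 0 < tstar) :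
    ∃ (κ c : ℝ) (K : Set (PhaseSpace N)), 0 < κ ∧ κ < 1 ∧ 0 < c ∧ IsCompact K ∧
      ∀ z : PhaseSpace N,
        ∫⁻ y, ENNReal.ofReal (Real.exp (θ * (pinnedChain ω₂ lam β γ).hamiltonian N y))
            ∂((pinnedChain ω₂ lam β γ).transitionKernel N T_L T_R tstar z) ≤
          ENNReal.ofReal (κ * Real.exp (θ * (pinnedChain ω₂ lam β γ).hamiltonian N z) +
            c * K.indicator 1 z) := by
  set P := pinnedChain ω₂ lam β γ with hP
  have hN0 : 0 < N := by omega
  obtain ⟨E₀, hE₀⟩ := pinnedChain_lintegral_exp_hamiltonian_small hω hl hβ hγ hN hTL hTR hθ hθ' (tstar := (tstar : ℝ))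
    (by exact_mod_cast hts)
  set K : Set (PhaseSpace N) := {z | P.hamiltonian N z ≤ E₀} with hK
  set c : ℝ := Real.exp (θ * γ * (T_L + T_R) * tstar) * Real.exp (θ * E₀) with hc
  have hmeas : Measurable fun y : PhaseSpace N => ENNReal.ofReal (Real.exp (θ * P.hamiltonian N y)) :=
    ENNReal.measurable_ofReal.comp (Real.measurable_exp.comp
      ((pinnedChain_continuous_hamiltonian ω₂ lam β γ N).measurable.const_mul _))
  refine ⟨1 / 2, c, K, by norm_num, by norm_num, by positivity,
    pinnedChain_isCompact_setOf_hamiltonian_le hω hl.le hβ.le γ N E₀, fun z => ?_⟩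
  rw [pinnedChain_lintegral_transitionKernel hω hl.le hβ.le hγ.le N T_L T_R tstar z hmeas]
  by_cases hz : z ∈ K
  · -- below the level: (3.4)
    have h34 := pinnedChain_lintegral_exp_hamiltonian_solMap_le hω hl.le hβ.le hγ.le hN0 hTL hTR hθ hθ' tstar z
    refine h34.trans (ENNReal.ofReal_le_ofReal ?_)
    rw [Set.indicator_of_mem hz, Pi.one_apply, mul_one]
    have hzE : P.hamiltonian N z ≤ E₀ := hz
    have h1 : Real.exp (θ * γ * (T_L + T_R) * tstar) * Real.exp (θ * P.hamiltonian N z) ≤ c := by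
      rw [hc]
      exact mul_le_mul_of_nonneg_left (Real.exp_le_exp.2 (mul_le_mul_of_nonneg_left hzE hθ.le)) (Real.exp_pos _).le
    have h2 : 0 ≤ 1 / 2 * Real.exp (θ * P.hamiltonian N z) := by positivity
    linarith only [h1, h2]
  · -- above the level: the high-energy estimate
    have hzE : E₀ ≤ P.hamiltonian N z := le_of_lt (not_le.1 hz)
    refine (hE₀ z hzE).trans (ENNReal.ofReal_le_ofReal ?_)
    rw [Set.indicator_of_notMem hz, mul_zero, add_zero]
    linarith only [Real.exp_pos (θ * P.hamiltonian N z)]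

/-- **Theorem 2.13 (2) for the pinned chain with `lam > 0`, `N ≥ 2`, PROVED**: the transition semigroup
`pinnedChainSemigroup` has an invariant probability measure integrating `e^{ϑH}` for every
`0 < ϑ < 1/max(T_L,T_R)` (Krylov–Bogoliubov with the Lyapunov family `(e^{ϑH})_ϑ`, H2 from
`pinnedChain_H2_of_pos` at `t* = 1`, (3.4) on `[0, 1)`; the proof pattern of
`LangevinChainLyapunov.lean` / `LangevinChainHarris.lean`). [cite: CuneoEckmannHairerReyBellet2018, Thm 2.13 (2) and Prop 3.7] -/
theorem pinnedChainSemigroup_exists_isInvariant_of_pos :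
    ∃ μ : Measure (PhaseSpace N), IsProbabilityMeasure μ ∧
      (pinnedChainSemigroup hω hl.le hβ.le hγ.le (by omega : 0 < N) hTL.le hTR.le).IsInvariant μ ∧
      ∀ ϑ : ℝ, 0 < ϑ → ϑ < 1 / max T_L T_R →
        Integrable (fun z => Real.exp (ϑ * (pinnedChain ω₂ lam β γ).hamiltonian N z)) μ := by
  have hN0 : 0 < N := by omega
  set S := pinnedChainSemigroup hω hl.le hβ.le hγ.le hN0 hTL.le hTR.le with hS
  have hF : ∀ (t : ℝ≥0) (g : PhaseSpace N →ᵇ ℝ), Continuous (S.act t g) :=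
    continuous_act_pinnedChainSemigroup hω hl.le hβ.le hγ.le hN0 hTL.le hTR.le
  have hTm : 0 < 1 / max T_L T_R := by positivity
  -- the family of Lyapunov functions `e^{ϑH}`, `0 < ϑ < 1/T_max`
  let ι := {ϑ : ℝ // 0 < ϑ ∧ ϑ < 1 / max T_L T_R}
  let V : ι → PhaseSpace N → ℝ≥0 := fun ϑ x =>
    (Real.exp (ϑ.1 * (pinnedChain ω₂ lam β γ).hamiltonian N x)).toNNReal
  have hVapply : ∀ (ϑ : ι) (x : PhaseSpace N),
      (V ϑ x : ℝ≥0∞) = ENNReal.ofReal (Real.exp (ϑ.1 * (pinnedChain ω₂ lam β γ).hamiltonian N x)) :=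
    fun ϑ x => rfl
  have hV : ∀ ϑ : ι, Continuous (V ϑ) := fun ϑ =>
    continuous_real_toNNReal.comp (Real.continuous_exp.comp
      (continuous_const.mul (pinnedChain_continuous_hamiltonian ω₂ lam β γ N)))
  -- H2 at `t* = 1` and (3.4) on `[0,1)`, in the form consumed by the abstract theorem
  have hlyap : ∀ ϑ : ι, ∃ (tstar : ℝ≥0) (a b c : ℝ≥0∞), 0 < tstar ∧ a < 1 ∧ b ≠ ⊤ ∧ c ≠ ⊤ ∧
      (∀ x, ∫⁻ y, V ϑ y ∂(S.kernel tstar x) ≤ a * V ϑ x + b) ∧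
      (∀ r : ℝ≥0, r < tstar → ∀ x, ∫⁻ y, V ϑ y ∂(S.kernel r x) ≤ c * V ϑ x) := by
    intro ϑ
    obtain ⟨a, c, K, ha0, ha1, hc, -, hbound⟩ := pinnedChain_H2_of_pos hω hl hβ hγ hN hTL hTR ϑ.2.1 ϑ.2.2 1 one_pos
    refine ⟨1, ENNReal.ofReal a, ENNReal.ofReal c,
      ENNReal.ofReal (Real.exp (ϑ.1 * γ * (T_L + T_R))), one_pos,
      ENNReal.ofReal_lt_one.2 ha1, ENNReal.ofReal_ne_top, ENNReal.ofReal_ne_top,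
      fun x => ?_, fun r hr x => ?_⟩
    · refine (hbound x).trans ?_
      rw [hVapply, ← ENNReal.ofReal_mul ha0.le,
        ← ENNReal.ofReal_add (by positivity) (by positivity)]
      refine ENNReal.ofReal_le_ofReal (add_le_add le_rfl ?_)
      calc c * K.indicator 1 x ≤ c * 1 := by
            refine mul_le_mul_of_nonneg_left ?_ hc.le
            exact Set.indicator_le_self' (fun _ _ => zero_le_one) x
        _ = c := mul_one c
    · refine (lintegral_exp_mul_hamiltonian_pinnedChainSemigroup_le hω hl.le hβ.le hγ.le hN0 hTL.le
        hTR.le hTL hTR ϑ.2.1 ϑ.2.2 r x).trans ?_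
      rw [hVapply, ← ENNReal.ofReal_mul (by positivity)]
      refine ENNReal.ofReal_le_ofReal (mul_le_mul_of_nonneg_right ?_ (by positivity))
      refine Real.exp_le_exp.2 ?_
      have hr' : ((r : ℝ≥0) : ℝ) ≤ 1 := by exact_mod_cast hr.le
      have h0 : 0 ≤ ϑ.1 * γ * (T_L + T_R) := by
        have := ϑ.2.1; positivity
      nlinarith
  -- a distinguished index with compact sublevel sets
  let ϑ₀ : ι := ⟨1 / max T_L T_R / 2, by positivity, half_lt_self hTm⟩
  have hcpt : ∀ R : ℝ≥0, IsCompact {x | V ϑ₀ x ≤ R} := fun R =>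
    pinnedChain_isCompact_setOf_exp_le hω hl.le hβ.le γ N (θ := ϑ₀.1) (by positivity) R
  obtain ⟨μ, hμ, hinv, hfin⟩ := MarkovSemigroup.exists_invariant_of_lyapunov S.kernel
    S.kernel_zero S.kernel_add S.measurable_kernel hF V hV hlyap ϑ₀ hcpt 0
  refine ⟨μ, hμ, hinv, fun ϑ h0 h1 => ?_⟩
  refine ⟨(Real.continuous_exp.comp (continuous_const.mul
    (pinnedChain_continuous_hamiltonian ω₂ lam β γ N))).aestronglyMeasurable, ?_⟩
  have hlt := hfin ⟨ϑ, h0, h1⟩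
  simp only [hVapply] at hlt
  show ∫⁻ x, ‖Real.exp (ϑ * (pinnedChain ω₂ lam β γ).hamiltonian N x)‖ₑ ∂μ < ⊤
  simpa only [Real.enorm_eq_ofReal (Real.exp_nonneg _)] using hlt

end H2

/-! ### The weak-stationarity fact from Hörmander's theorem alone -/

/-- **The named fact `CuneoEckmannHairerReyBellet2018_pinnedChain` follows from Hörmander's
hypoellipticity theorem** (`Literature.Analysis.Distribution.Hormander1967_thm11`) — the Lyapunov
half of the printed proof of Theorem 2.13 (H2: CEHR Thm 5.1) being now PROVED in the tree: for
`N = 1` the Gibbs measure at the mean temperature is a steady state (`LangevinChainGibbs.lean`,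
`CuneoEckmannHairerReyBellet2018_pinnedChain_one`); for `N ≥ 2` the invariant probability measure of
the constructed transition semigroup (`pinnedChainSemigroup_exists_isInvariant_of_pos`: H2 +
Krylov–Bogoliubov) integrates `e^{ϑH}`, hence the bond currents, is weakly stationary by Dynkin's
identity (`pinnedChain_isSteadyState_of_isInvariant`), and has a smooth density by Hörmander's
theorem with the bracket condition of Prop. 4.1
(`CuneoEckmannHairerReyBellet2018_smoothDensity_of_hormander`), so it is absolutely continuous.
[cite: CuneoEckmannHairerReyBellet2018, Thm 2.13] -/
theorem CuneoEckmannHairerReyBellet2018_pinnedChain_of_hormander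
    (hH : Literature.Analysis.Distribution.Hormander1967_thm11) : CuneoEckmannHairerReyBellet2018_pinnedChain := by
  intro ω₂ lam β γ hω hl hβ hγ N T_L T_R hN hL hR
  rcases Nat.lt_or_ge 1 N with hN2 | hN1
  · -- `N ≥ 2`
    obtain ⟨μ, hμ, hinv, hint⟩ := pinnedChainSemigroup_exists_isInvariant_of_pos hω hl hβ hγ hN2 hL hR
    have hmax : 0 < max T_L T_R := lt_max_of_lt_left hL
    have hϑ0 : 0 < 1 / max T_L T_R / 2 := by positivity
    have hϑ1 : 1 / max T_L T_R / 2 < 1 / max T_L T_R := half_lt_self (by positivity)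
    set S := pinnedChainSemigroup hω hl.le hβ.le hγ.le (by omega : 0 < N) hL.le hR.le with hS
    refine ⟨μ, pinnedChain_isSteadyState_of_isInvariant hω.le hl.le hβ.le γ N S hinv hϑ0 (hint _ hϑ0 hϑ1), ?_, hint⟩
    exact ((CuneoEckmannHairerReyBellet2018_smoothDensity_of_hormander hH).hasSmoothDensity_of_isInvariant
      hω hl.le hβ hγ (by omega) hL hR S μ hinv).absolutelyContinuous
  · -- `N = 1`
    obtain rfl : N = 1 := le_antisymm hN1 hN
    exact CuneoEckmannHairerReyBellet2018_pinnedChain_one hω hl.le hβ.le γ hL hR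

end Literature.MathematicalPhysics.KineticTheory.HeatConduction
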